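import Mathlib.Combinatorics.SimpleGraph.Regularity.Lemma
import Mathlib.Data.Fin.Tuple.Finset
import Mathlib.Data.Real.Basic
import Mathlib.Tactic.Linarith
import Mathlib.Tactic.Positivity
import Mathlib.Tactic.Ring
import Mathlib.Tactic.FieldSimp
import Mathlib.Algebra.Order.BigOperators.Group.Finset
import Mathlib.Algebra.Order.BigOperators.Ring.Finset
import Mathlib.Algebra.BigOperators.Fin
import Literature.Combinatorics.Additive.ArithmeticRemoval
import HarnessLib

/-!
# Proof of the arithmetic removal lemma (Green 2005, Thm. 1.5)

Topic `Literature/Combinatorics/Additive`. This file DISCHARGES the named fact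
`Literature.Combinatorics.Additive.Green2005_1_5` (file `ArithmeticRemoval.lean`):

* `Green2005_1_5_holds : Green2005_1_5` — B. Green, *A Szemerédi-type regularity lemma in abelian
  groups, with applications*, GAFA 15 (2005) 340–376, Thm. 1.5 (arXiv:math/0310476, 'Theorem 5' on
  p. 3 and §7 of the arXiv render): for `k ≥ 3`, `ε > 0` there is `δ = δ(k, ε) > 0` such that for
  every finite abelian group `G` (order `N`) and `A_1, …, A_k ⊆ G` with at most `δ N^{k-1}`
  zero-sum `k`-tuples in `∏ A_i` one can delete `≤ ε N` elements from each `A_i` and destroy all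
  zero-sum `k`-tuples.

## The proof formalised

Green proves Thm. 1.5 through his arithmetic regularity lemma (ibid. Thm. 5.3: Bohr sets, a
tower-type iteration) and an arithmetic counting lemma (ibid. §6–7). We do NOT follow that road.
Instead we formalise the combinatorial proof of D. Král', O. Serra, L. Vena, *A combinatorial
proof of the removal lemma for groups*, JCTA 116 (2009) 971–978 (arXiv:0804.4847), §2 "Proof of
Theorem 2" (their Theorem 1 is Green's Thm. 1.5 verbatim; Theorem 2 extends it to all finite
groups), which needs from graph theory only a removal lemma for `k`-cycles, and we prove that
removal lemma here from Mathlib's Szemerédi regularity lemma (`szemeredi_regularity`, the reduced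
graph `SimpleGraph.regularityReduced` and the edge counts of
`Mathlib.Combinatorics.SimpleGraph.Regularity.Uniform`; Mathlib itself only has the triangle case,
`SimpleGraph.triangle_removal`). Everything graph-theoretic is in the sub-namespace
`Literature.Combinatorics.Additive.KralSerraVena` (named after the paper whose §2 it formalises):

1. **Path and cycle counting** (`le_card_pathSet`, `le_card_cycSet`): if consecutive sets
   `X i, X (i+1)` (indices mod `k`, `k = n + 3`) of a graph form `ε`-uniform pairs of density
   `≥ d ≥ 4ε`, then at least `(d/4)^k ∏ |X i|` tuples `(x_i) ∈ ∏ X i` satisfy `x_i ∼ x_{i+1}` for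
   all `i` (`cycSet`). Standard one-sided counting: all but `ε|X 0|` vertices have `(d-ε)|X 1|`
   neighbours in `X 1` (`card_badVertices_le`, as in Mathlib's triangle counting), and paths are
   counted by peeling off the first vertex (`sum_card_pathSet_le`, induction on the length).
2. **Slicing** (`isUniform_slice`): subsets of relative size `≥ α` of an `ε`-uniform pair form
   an `ε/α`-uniform pair.
3. **Removal lemma for "around" cycles** (`around_cycle_removal`): in a graph `Γ` on
   `Fin k × β`, call `y : Fin k → β` an around tuple if `(i, y i) ∼ (i+1, y (i+1))` for all `i`
   (`aroundSet`). If there are `≤ δ |β|^k` around tuples then deleting `≤ ε |β|²` ordered edges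
   kills them all. Proof: regularity partition `P` (parameter `ε₀`), cleaned graph `cleaned`
   = `regularityReduced P ε₀ η` minus the edges at *bad* vertices (those lying in a part in
   which their own layer `{i} × β` has proportion `< α`); edge count
   `card_removedPairs_cleaned_le`; a surviving around tuple passes through parts
   `U_0, …, U_{k-1}` with `(U_i, U_{i+1})` uniform and dense, the layer slices
   `U_i ∩ ({i} × β)` are large, uniform and dense by slicing, so the counting lemma produces
   `≥ c |β|^k` around tuples of `Γ` (`le_card_aroundSet_of_mem_cleaned`), a contradiction. This is
   the (undirected, partite) cycle case of the graph removal lemma; Král'–Serra–Vena invoke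
   instead the directed removal lemma of Alon–Shapira (their Lemma 6).
4. **The layered Cayley graph** (`cayleyLayered`, KSV §2): vertices `Fin k × G`,
   `(i, x) ∼ (i+1, y)` iff `y - x ∈ A i` (undirected; for `k ≥ 3` the pair of layers determines
   the direction, `cayleyLayered_adj_iff`). Around tuples inject into (base point) × (zero-sum
   tuples) (`card_aroundSet_cayleyLayered_le`), the missing edges labelled by `a ∈ A i` are
   removed pairs (`sum_badCount_le`), an element is deleted from `A i` when `≥ N/k` of its `N`
   edges are missing, and a surviving zero-sum tuple yields, through its partial sums
   (`exists_partialSum`), `N` around tuples of the Cayley graph each missing an edge of the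
   cleaned graph — more than the deleted elements allow (`sum_ne_zero_of_aroundSet_eq_empty`).
5. `arithmetic_removal_aux` assembles the constants for `k = n + 3`; `Green2005_1_5_holds`
   substitutes `k = n + 3`.

All bounds are of tower type (through `SzemerediRegularity.bound`), as in both sources. All
definitions in this file (`pathSet`, `consV`, `cycSet`, `shiftFam`, `aroundSet`, `removedPairs`,
`layerPiece`, `cleaned`, `cayleyLayered`, `badCount`) are proof-internal.

## References
* B. Green, GAFA 15 (2005) 340–376, Thm. 1.5 and §7. [cite: Green2005]
* D. Král', O. Serra, L. Vena, JCTA 116 (2009) 971–978, Thm. 1, Thm. 2 and §2 (proof of Thm. 2),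
  Lemma 6 (= N. Alon, A. Shapira, *Testing subgraphs in directed graphs*, JCSS 69 (2004),
  Lemma 4.1). [cite: KralSerraVena2009]
* Y. Dillies, B. Mehta, *Formalising Szemerédi's regularity lemma in Lean*, ITP 2022 (Mathlib's
  `Mathlib.Combinatorics.SimpleGraph.Regularity.*` and `Triangle.*`, whose triangle counting and
  removal files this one imitates for `k`-cycles).
-/

open Finset Fintype

namespace Literature.Combinatorics.Additive.KralSerraVena

variable {V : Type*} (Γ : SimpleGraph V) [DecidableRel Γ.Adj]

/-- The number of edges between `s` and `t` is the sum over `x ∈ s` of the degree of `x` into `t`.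
[folklore] -/
theorem card_interedges_eq_sum (s t : Finset V) :
    #(Γ.interedges s t) = ∑ x ∈ s, #(t.filter (Γ.Adj x)) := by
  rw [SimpleGraph.interedges_def, Finset.card_filter, Finset.sum_product]
  refine Finset.sum_congr rfl fun x _ => ?_
  rw [Finset.card_filter]

/-- In an `ε`-uniform pair `(s, t)` of density `≥ d`, at most `ε |s|` vertices of `s` have fewer
than `(d - ε)|t|` neighbours in `t`. [folklore] -/
theorem card_badVertices_le {ε d : ℝ} {s t : Finset V} (hU : Γ.IsUniform ε s t)
    (hd : d ≤ Γ.edgeDensity s t) (hε1 : ε ≤ 1) :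
    (#{x ∈ s | (#(t.filter (Γ.Adj x)) : ℝ) < (d - ε) * #t} : ℝ) ≤ ε * #s := by
  set B := {x ∈ s | (#(t.filter (Γ.Adj x)) : ℝ) < (d - ε) * #t} with hB
  have hε0 : 0 < ε := hU.pos
  by_contra! h
  have hBs : B ⊆ s := filter_subset _ _
  have hBpos : (0 : ℝ) < #B := lt_of_le_of_lt (by positivity) h
  have hBne : B.Nonempty := by
    rw [← Finset.card_pos]
    exact_mod_cast hBpos
  have hsum : (#(Γ.interedges B t) : ℝ) < (d - ε) * #t * #B := by
    rw [card_interedges_eq_sum]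
    push_cast
    calc (∑ x ∈ B, (#(t.filter (Γ.Adj x)) : ℝ)) < ∑ x ∈ B, (d - ε) * #t :=
          Finset.sum_lt_sum_of_nonempty hBne (fun x hx => (mem_filter.1 hx).2)
      _ = (d - ε) * #t * #B := by rw [sum_const, nsmul_eq_mul]; ring
  have htpos : (0 : ℝ) < #t := by
    rcases t.eq_empty_or_nonempty with ht | ht
    · exfalso
      have h0 : (#(Γ.interedges B t) : ℝ) < 0 := by simpa [ht] using hsum
      linarith [Nat.cast_nonneg (α := ℝ) #(Γ.interedges B t)]
    · exact_mod_cast ht.card_pos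
  have huni := hU hBs Subset.rfl (by linarith) (by nlinarith)
  rw [abs_sub_lt_iff] at huni
  have hdens : (Γ.edgeDensity B t : ℝ) = #(Γ.interedges B t) / (#B * #t) := by
    rw [SimpleGraph.edgeDensity_def]; push_cast; rfl
  have h2 : (d - ε) < (Γ.edgeDensity B t : ℝ) := by linarith [huni.2]
  rw [hdens, lt_div_iff₀ (by positivity)] at h2
  linarith

/-- Between large subsets of an `ε`-uniform pair of density `≥ d` there are at least
`(d - ε)|S||T|` edges. [folklore] -/
theorem le_card_interedges_of_isUniform {ε d : ℝ} {s t S T : Finset V} (hU : Γ.IsUniform ε s t)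
    (hd : d ≤ Γ.edgeDensity s t) (hS : S ⊆ s) (hT : T ⊆ t) (hSc : ε * #s ≤ #S)
    (hTc : ε * #t ≤ #T) :
    (d - ε) * #S * #T ≤ #(Γ.interedges S T) := by
  rcases S.eq_empty_or_nonempty with hS0 | hSne
  · simp [hS0]
  rcases T.eq_empty_or_nonempty with hT0 | hTne
  · simp [hT0]
  have hSpos : (0 : ℝ) < #S := by exact_mod_cast hSne.card_pos
  have hTpos : (0 : ℝ) < #T := by exact_mod_cast hTne.card_pos
  have huni := hU hS hT (by linarith) (by linarith)
  rw [abs_sub_lt_iff] at huni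
  have hdens : (Γ.edgeDensity S T : ℝ) = #(Γ.interedges S T) / (#S * #T) := by
    rw [SimpleGraph.edgeDensity_def]; push_cast; rfl
  have h2 : (d - ε) ≤ (Γ.edgeDensity S T : ℝ) := by linarith [huni.2]
  rw [hdens, le_div_iff₀ (by positivity)] at h2
  linarith


/-! ### Paths through a sequence of sets -/

section Paths

variable [DecidableEq V]

/-- Paths with `m` edges through the sets `Z 0, …, Z m` (vertex `j` in `Z j`), starting in `S`
and ending in `T`. [folklore] -/
def pathSet (m : ℕ) (Z : ℕ → Finset V) (S T : Finset V) : Finset (Fin (m + 1) → V) :=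
  (Fintype.piFinset fun j : Fin (m + 1) => Z j).filter fun p =>
    p 0 ∈ S ∧ p (Fin.last m) ∈ T ∧ ∀ j : Fin m, Γ.Adj (p j.castSucc) (p j.succ)

/-- Membership in `pathSet`. [folklore] -/
theorem mem_pathSet {m : ℕ} {Z : ℕ → Finset V} {S T : Finset V} {p : Fin (m + 1) → V} :
    p ∈ pathSet Γ m Z S T ↔ (∀ j : Fin (m + 1), p j ∈ Z (j : ℕ)) ∧ p 0 ∈ S ∧ p (Fin.last m) ∈ T ∧
      ∀ j : Fin m, Γ.Adj (p j.castSucc) (p j.succ) := by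
  simp [pathSet, Fintype.mem_piFinset]

/-- Prepending a vertex to a tuple (a non-dependent `Fin.cons`). [folklore] -/
def consV {m : ℕ} (z : V) (p : Fin (m + 1) → V) : Fin (m + 2) → V := Fin.cons z p

omit [DecidableRel Γ.Adj] [DecidableEq V] in
/-- `consV z p 0 = z`. [folklore] -/
@[simp] theorem consV_zero {m : ℕ} (z : V) (p : Fin (m + 1) → V) : consV z p 0 = z := rfl

omit [DecidableRel Γ.Adj] [DecidableEq V] in
/-- `consV z p (j+1) = p j`. [folklore] -/
@[simp] theorem consV_succ {m : ℕ} (z : V) (p : Fin (m + 1) → V) (j : Fin (m + 1)) :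
    consV z p j.succ = p j := by
  simp [consV]

omit [DecidableRel Γ.Adj] [DecidableEq V] in
/-- `consV z` is injective. [folklore] -/
theorem consV_injective {m : ℕ} (z : V) : Function.Injective (consV (m := m) z) := by
  intro p q h
  have : (Fin.cons z p : Fin (m + 2) → V) = Fin.cons z q := h
  exact Fin.cons_right_injective (α := fun _ : Fin (m + 2) => V) z this

omit [DecidableRel Γ.Adj] [DecidableEq V] in
/-- `consV z p 1 = p 0`. [folklore] -/
@[simp] theorem consV_one {m : ℕ} (z : V) (p : Fin (m + 1) → V) : consV z p 1 = p 0 := by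
  rw [← Fin.succ_zero_eq_one, consV_succ]

/-- Prepending a vertex to a path. [folklore] -/
theorem cons_mem_pathSet {m : ℕ} {Z : ℕ → Finset V} {S T : Finset V} {z : V}
    (hz0 : z ∈ Z 0) (hzS : z ∈ S) {p : Fin (m + 1) → V}
    (hp : p ∈ pathSet Γ m (fun j => Z (j + 1)) ((Z 1).filter (Γ.Adj z)) T) :
    consV z p ∈ pathSet Γ (m + 1) Z S T := by
  rw [mem_pathSet] at hp ⊢
  obtain ⟨hpZ, hp0, hpT, hpA⟩ := hp
  refine ⟨?_, ?_, ?_, ?_⟩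
  · intro j
    refine Fin.cases ?_ (fun i => ?_) j
    · simpa using hz0
    · simpa using hpZ i
  · simpa using hzS
  · rw [← Fin.succ_last, consV_succ]
    exact hpT
  · intro j
    refine Fin.cases ?_ (fun i => ?_) j
    · have h1 : Γ.Adj z (p 0) := (mem_filter.1 hp0).2
      simpa using h1
    · rw [← Fin.succ_castSucc, consV_succ, consV_succ]
      exact hpA i

/-- Peeling off the first vertex: a lower bound for the number of paths by the paths through the
neighbourhoods of the possible first vertices. [folklore] -/
theorem sum_card_pathSet_le {m : ℕ} (Z : ℕ → Finset V) (S T S' : Finset V) (hS' : S' ⊆ S)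
    (hS'0 : S' ⊆ Z 0) :
    ∑ z ∈ S', #(pathSet Γ m (fun j => Z (j + 1)) ((Z 1).filter (Γ.Adj z)) T) ≤
      #(pathSet Γ (m + 1) Z S T) := by
  classical
  calc ∑ z ∈ S', #(pathSet Γ m (fun j => Z (j + 1)) ((Z 1).filter (Γ.Adj z)) T)
      = ∑ z ∈ S', #((pathSet Γ m (fun j => Z (j + 1)) ((Z 1).filter (Γ.Adj z)) T).image
          (consV z)) := by
        refine sum_congr rfl fun z _ => ?_
        rw [card_image_of_injective _ (consV_injective z)]
    _ = #(S'.biUnion fun z => (pathSet Γ m (fun j => Z (j + 1)) ((Z 1).filter (Γ.Adj z)) T).image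
          (consV z)) := by
        rw [card_biUnion]
        intro z _ z' _ hzz'
        rw [Function.onFun, Finset.disjoint_left]
        intro q hq hq'
        rw [mem_image] at hq hq'
        obtain ⟨p, -, rfl⟩ := hq
        obtain ⟨p', -, h⟩ := hq'
        apply hzz'
        have := congr_fun h 0
        simp only [consV_zero] at this
        exact this.symm
    _ ≤ #(pathSet Γ (m + 1) Z S T) := by
        refine card_le_card ?_
        intro q hq
        rw [mem_biUnion] at hq
        obtain ⟨z, hz, hq⟩ := hq
        rw [mem_image] at hq
        obtain ⟨p, hp, rfl⟩ := hq
        exact cons_mem_pathSet Γ (hS'0 hz) (hS' hz) hp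

/-- Paths with no edge: the number of one-vertex paths is the size of `Z 0 ∩ S ∩ T`. [folklore] -/
theorem card_pathSet_zero (Z : ℕ → Finset V) (S T : Finset V) :
    #(T.filter fun x => x ∈ Z 0 ∧ x ∈ S) ≤ #(pathSet Γ 0 Z S T) := by
  refine card_le_card_of_injOn (fun x => fun _ => x) ?_ ?_
  · intro x hx
    rw [mem_coe, mem_filter] at hx
    rw [mem_coe, mem_pathSet]
    refine ⟨fun j => ?_, hx.2.2, hx.1, fun j => j.elim0⟩
    have : (j : ℕ) = 0 := by omega
    rw [this]; exact hx.2.1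
  · intro x _ y _ hxy
    exact congr_fun hxy 0

/-- **Path counting lemma** (one-sided). If consecutive sets `Z j, Z (j+1)` (`j ≤ n`) form
`ε`-uniform pairs of density `≥ d ≥ 4ε`, then the number of paths `z_0 ∼ z_1 ∼ ⋯ ∼ z_{n+1}` with
`z_j ∈ Z j`, `z_0 ∈ S` and `z_{n+1} ∈ T` is at least `(d/2)^{n+1} 2^{-n} |S| |Z 1| ⋯ |Z n| |T|`
whenever `|S| ≥ 2ε|Z 0|` and `|T| ≥ ε |Z (n+1)|`. [folklore] -/
theorem le_card_pathSet {ε d : ℝ} (hεd : 4 * ε ≤ d) (hd1 : d ≤ 1) :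
    ∀ (n : ℕ) (Z : ℕ → Finset V) (S T : Finset V),
    (∀ j ≤ n, Γ.IsUniform ε (Z j) (Z (j + 1)) ∧ d ≤ Γ.edgeDensity (Z j) (Z (j + 1))) →
    S ⊆ Z 0 → 2 * ε * #(Z 0) ≤ #S → T ⊆ Z (n + 1) → ε * #(Z (n + 1)) ≤ #T →
    (d / 2) ^ (n + 1) / 2 ^ n * #S * (∏ j ∈ range n, (#(Z (j + 1)) : ℝ)) * #T ≤
      #(pathSet Γ (n + 1) Z S T) := by
  intro n
  induction n with
  | zero =>
    intro Z S T hZ hS hSc hT hTc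
    obtain ⟨hU, hdens⟩ := hZ 0 le_rfl
    simp only [zero_add] at hU hdens
    have hε0 : 0 < ε := hU.pos
    have h1 := sum_card_pathSet_le Γ (m := 0) Z S T S Subset.rfl hS
    have h2 : ∀ z ∈ S, #(T.filter (Γ.Adj z)) ≤
        #(pathSet Γ 0 (fun j => Z (j + 1)) ((Z 1).filter (Γ.Adj z)) T) := by
      intro z _
      refine le_trans (card_le_card ?_) (card_pathSet_zero Γ _ _ _)
      intro x hx
      rw [mem_filter] at hx ⊢
      exact ⟨hx.1, hT hx.1, mem_filter.2 ⟨hT hx.1, hx.2⟩⟩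
    have h3 : (d - ε) * #S * #T ≤ #(Γ.interedges S T) :=
      le_card_interedges_of_isUniform Γ hU hdens hS hT
        (by nlinarith [hSc, hε0.le, Nat.cast_nonneg (α := ℝ) #(Z 0)]) hTc
    rw [card_interedges_eq_sum] at h3
    have h4 : (∑ x ∈ S, #(T.filter (Γ.Adj x)) : ℕ) ≤ #(pathSet Γ 1 Z S T) :=
      le_trans (sum_le_sum h2) h1
    have h5 : (0 : ℝ) ≤ #S * #T := by positivity
    calc (d / 2) ^ (0 + 1) / 2 ^ 0 * #S * (∏ j ∈ range 0, (#(Z (j + 1)) : ℝ)) * #T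
        = (d / 2) * (#S * #T) := by simp; ring
      _ ≤ (d - ε) * (#S * #T) := by
          apply mul_le_mul_of_nonneg_right _ h5; linarith
      _ = (d - ε) * #S * #T := by ring
      _ ≤ _ := h3
      _ ≤ _ := by exact_mod_cast h4
  | succ n ih =>
    intro Z S T hZ hS hSc hT hTc
    obtain ⟨hU, hdens⟩ := hZ 0 (Nat.zero_le _)
    simp only [zero_add] at hU hdens
    have hε0 : 0 < ε := hU.pos
    have hd0 : 0 ≤ d := by linarith
    -- the vertices of `Z 0` with few neighbours in `Z 1`
    obtain ⟨B, hB⟩ : ∃ B : Finset V,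
        B = {x ∈ Z 0 | (#((Z 1).filter (Γ.Adj x)) : ℝ) < (d - ε) * #(Z 1)} := ⟨_, rfl⟩
    have hBcard : (#B : ℝ) ≤ ε * #(Z 0) := by
      rw [hB]; exact card_badVertices_le Γ hU hdens (by linarith)
    have hS'S : S \ B ⊆ S := sdiff_subset
    have hS'card : (#S : ℝ) / 2 ≤ #(S \ B) := by
      have h1 : #S - #B ≤ #(S \ B) := le_card_sdiff B S
      have h2 : #S ≤ #(S \ B) + #B := by omega
      have h3 : (#S : ℝ) ≤ #(S \ B) + #B := by exact_mod_cast h2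
      linarith
    have hdeg : ∀ z ∈ S \ B, (d - ε) * #(Z 1) ≤ #((Z 1).filter (Γ.Adj z)) := by
      intro z hz
      have hzB : z ∉ B := (mem_sdiff.1 hz).2
      have hz0 : z ∈ Z 0 := hS ((mem_sdiff.1 hz).1)
      have : ¬ ((#((Z 1).filter (Γ.Adj z)) : ℝ) < (d - ε) * #(Z 1)) := by
        intro h; rw [hB] at hzB; exact hzB (mem_filter.2 ⟨hz0, h⟩)
      exact not_lt.1 this
    have hIH : ∀ z ∈ S \ B, (d / 2) ^ (n + 1) / 2 ^ n * #((Z 1).filter (Γ.Adj z)) *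
        (∏ j ∈ range n, (#(Z (j + 1 + 1)) : ℝ)) * #T ≤
        #(pathSet Γ (n + 1) (fun j => Z (j + 1)) ((Z 1).filter (Γ.Adj z)) T) := by
      intro z hz
      have key := ih (fun j => Z (j + 1)) ((Z 1).filter (Γ.Adj z)) T
        (fun j hj => hZ (j + 1) (by omega)) (by simp [filter_subset]) ?_ hT hTc
      · simpa using key
      · have := hdeg z hz
        simp only [zero_add]
        nlinarith [this, Nat.cast_nonneg (α := ℝ) #(Z 1)]
    have hsum := sum_card_pathSet_le Γ (m := n + 1) Z S T (S \ B) hS'S (fun z hz => hS (hS'S hz))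
    have hC : (0 : ℝ) ≤ (d / 2) ^ (n + 1) / 2 ^ n *
        (∏ j ∈ range n, (#(Z (j + 1 + 1)) : ℝ)) * #T :=
      mul_nonneg (mul_nonneg (div_nonneg (pow_nonneg (by linarith) _) (pow_nonneg (by norm_num) _))
        (prod_nonneg fun j _ => Nat.cast_nonneg _)) (Nat.cast_nonneg _)
    have hZ1 : (0 : ℝ) ≤ #(Z 1) := Nat.cast_nonneg _
    calc (d / 2) ^ (n + 1 + 1) / 2 ^ (n + 1) * #S * (∏ j ∈ range (n + 1), (#(Z (j + 1)) : ℝ)) * #T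
        = (#S / 2) * ((d / 2) * #(Z 1)) *
            ((d / 2) ^ (n + 1) / 2 ^ n * (∏ j ∈ range n, (#(Z (j + 1 + 1)) : ℝ)) * #T) := by
          rw [prod_range_succ']; ring
      _ ≤ #(S \ B) * ((d - ε) * #(Z 1)) *
            ((d / 2) ^ (n + 1) / 2 ^ n * (∏ j ∈ range n, (#(Z (j + 1 + 1)) : ℝ)) * #T) := by
          apply mul_le_mul_of_nonneg_right _ hC
          apply mul_le_mul hS'card _ (mul_nonneg (by linarith) hZ1) (Nat.cast_nonneg _)
          apply mul_le_mul_of_nonneg_right _ hZ1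
          linarith
      _ = ∑ z ∈ S \ B, ((d - ε) * #(Z 1)) *
            ((d / 2) ^ (n + 1) / 2 ^ n * (∏ j ∈ range n, (#(Z (j + 1 + 1)) : ℝ)) * #T) := by
          rw [sum_const, nsmul_eq_mul]; ring
      _ ≤ ∑ z ∈ S \ B, (#((Z 1).filter (Γ.Adj z)) : ℝ) *
            ((d / 2) ^ (n + 1) / 2 ^ n * (∏ j ∈ range n, (#(Z (j + 1 + 1)) : ℝ)) * #T) := by
          refine sum_le_sum fun z hz => ?_
          exact mul_le_mul_of_nonneg_right (hdeg z hz) hC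
      _ ≤ ∑ z ∈ S \ B,
            (#(pathSet Γ (n + 1) (fun j => Z (j + 1)) ((Z 1).filter (Γ.Adj z)) T) : ℝ) := by
          refine sum_le_sum fun z hz => ?_
          have := hIH z hz
          calc _ = (d / 2) ^ (n + 1) / 2 ^ n * #((Z 1).filter (Γ.Adj z)) *
              (∏ j ∈ range n, (#(Z (j + 1 + 1)) : ℝ)) * #T := by ring
            _ ≤ _ := this
      _ ≤ #(pathSet Γ (n + 1 + 1) Z S T) := by exact_mod_cast hsum

/-! ### Cycles through a cyclic sequence of sets -/

/-- The `k`-tuples `(x_i)_{i ∈ Fin k}` with `x_i ∈ X i` and `x_i ∼ x_{i+1}` for all `i`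
(indices mod `k`): homomorphic copies of the `k`-cycle through the sets `X 0, …, X (k-1)` in this
cyclic order. [folklore] -/
def cycSet {n : ℕ} (X : Fin (n + 1) → Finset V) : Finset (Fin (n + 1) → V) :=
  (Fintype.piFinset X).filter fun x => ∀ i, Γ.Adj (x i) (x (i + 1))

omit [DecidableEq V] in
/-- Membership in `cycSet`. [folklore] -/
theorem mem_cycSet {n : ℕ} {X : Fin (n + 1) → Finset V} {x : Fin (n + 1) → V} :
    x ∈ cycSet Γ X ↔ (∀ i, x i ∈ X i) ∧ ∀ i, Γ.Adj (x i) (x (i + 1)) := by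
  simp [cycSet, Fintype.mem_piFinset]

/-- The shifted family `j ↦ X (j+1)` (as an `ℕ`-indexed family, `∅` beyond the range).
[folklore] -/
def shiftFam {n : ℕ} (X : Fin (n + 3) → Finset V) (j : ℕ) : Finset V :=
  if h : j + 1 < n + 3 then X ⟨j + 1, h⟩ else ∅

omit [DecidableRel Γ.Adj] [DecidableEq V] in
/-- `shiftFam X j = X (j+1)` in range. [folklore] -/
theorem shiftFam_eq {n : ℕ} (X : Fin (n + 3) → Finset V) (j : Fin (n + 2)) :
    shiftFam X j = X j.succ := by
  unfold shiftFam
  rw [dif_pos (by simp [j.isLt])]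
  rfl

/-- Closing a path into a cycle: prepending `x₀` to a path from `N(x₀) ∩ X 1` to
`N(x₀) ∩ X (n+2)` through `X 2, …, X (n+1)` gives an element of `cycSet`. [folklore] -/
theorem consV_mem_cycSet {n : ℕ} {X : Fin (n + 3) → Finset V} {x₀ : V} (hx₀ : x₀ ∈ X 0)
    {p : Fin (n + 2) → V}
    (hp : p ∈ pathSet Γ (n + 1) (shiftFam X) ((X 1).filter (Γ.Adj x₀))
      ((X (Fin.last (n + 2))).filter (Γ.Adj x₀))) :
    consV x₀ p ∈ cycSet Γ X := by
  rw [mem_pathSet] at hp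
  obtain ⟨hpZ, hp0, hpT, hpA⟩ := hp
  rw [mem_cycSet]
  refine ⟨fun i => Fin.cases ?_ (fun j => ?_) i, fun i => Fin.cases ?_ (fun j => ?_) i⟩
  · simpa using hx₀
  · rw [consV_succ, ← shiftFam_eq X j]
    exact hpZ j
  · simpa using (mem_filter.1 hp0).2
  · refine Fin.lastCases ?_ (fun j' => ?_) j
    · rw [consV_succ, Fin.succ_last, Fin.last_add_one, consV_zero]
      exact ((mem_filter.1 hpT).2).symm
    · have e : (j'.castSucc.succ : Fin (n + 3)) + 1 = j'.succ.succ := by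
        rw [Fin.succ_castSucc]; exact Fin.coeSucc_eq_succ
      rw [e, consV_succ, consV_succ]
      exact hpA j'

/-- **Cycle counting lemma** (one-sided). If the consecutive pairs `(X i, X (i+1))` (indices
mod `n + 3`) are `ε`-uniform of density `≥ d ≥ 4ε`, then at least `(d/4)^{n+3} ∏ |X i|` tuples
lie in `cycSet Γ X`. [folklore] -/
theorem le_card_cycSet {ε d : ℝ} (hεd : 4 * ε ≤ d) (hd1 : d ≤ 1) {n : ℕ}
    (X : Fin (n + 3) → Finset V)
    (hX : ∀ i, Γ.IsUniform ε (X i) (X (i + 1)) ∧ d ≤ Γ.edgeDensity (X i) (X (i + 1))) :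
    (d / 4) ^ (n + 3) * ∏ i, (#(X i) : ℝ) ≤ #(cycSet Γ X) := by
  have hε0 : 0 < ε := (hX 0).1.pos
  have hd0 : 0 ≤ d := by linarith
  set L := Fin.last (n + 2) with hL
  -- uniformity data for the pairs `(X 0, X 1)` and `(X 0, X L)`
  have hU01 : Γ.IsUniform ε (X 0) (X 1) := by simpa using (hX 0).1
  have hd01 : d ≤ Γ.edgeDensity (X 0) (X 1) := by simpa using (hX 0).2
  have hU0L : Γ.IsUniform ε (X 0) (X L) := by
    have := (hX L).1
    rw [hL, Fin.last_add_one] at this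
    exact this.symm
  have hd0L : d ≤ Γ.edgeDensity (X 0) (X L) := by
    have := (hX L).2
    rw [hL, Fin.last_add_one] at this
    rwa [SimpleGraph.edgeDensity_comm]
  -- bad vertices of `X 0`
  obtain ⟨B₁, hB₁⟩ : ∃ B : Finset V,
      B = {x ∈ X 0 | (#((X 1).filter (Γ.Adj x)) : ℝ) < (d - ε) * #(X 1)} := ⟨_, rfl⟩
  obtain ⟨B₂, hB₂⟩ : ∃ B : Finset V,
      B = {x ∈ X 0 | (#((X L).filter (Γ.Adj x)) : ℝ) < (d - ε) * #(X L)} := ⟨_, rfl⟩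
  have hB₁c : (#B₁ : ℝ) ≤ ε * #(X 0) := by
    rw [hB₁]; exact card_badVertices_le Γ hU01 hd01 (by linarith)
  have hB₂c : (#B₂ : ℝ) ≤ ε * #(X 0) := by
    rw [hB₂]; exact card_badVertices_le Γ hU0L hd0L (by linarith)
  have hGsub : X 0 \ (B₁ ∪ B₂) ⊆ X 0 := sdiff_subset
  have hGcard : (#(X 0) : ℝ) / 2 ≤ #(X 0 \ (B₁ ∪ B₂)) := by
    have h1 : #(X 0) - #(B₁ ∪ B₂) ≤ #(X 0 \ (B₁ ∪ B₂)) := le_card_sdiff _ _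
    have h2 : #(X 0) ≤ #(X 0 \ (B₁ ∪ B₂)) + #(B₁ ∪ B₂) := by omega
    have h3 : #(B₁ ∪ B₂) ≤ #B₁ + #B₂ := card_union_le _ _
    have h4 : (#(X 0) : ℝ) ≤ #(X 0 \ (B₁ ∪ B₂)) + #B₁ + #B₂ := by exact_mod_cast (by omega)
    have h5 : ε ≤ 1 / 4 := by linarith
    nlinarith [h4, hB₁c, hB₂c, h5, Nat.cast_nonneg (α := ℝ) #(X 0)]
  have hdeg : ∀ x ∈ X 0 \ (B₁ ∪ B₂), (d - ε) * #(X 1) ≤ #((X 1).filter (Γ.Adj x)) ∧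
      (d - ε) * #(X L) ≤ #((X L).filter (Γ.Adj x)) := by
    intro x hx
    rw [mem_sdiff, mem_union, not_or] at hx
    obtain ⟨hx0, hx1, hx2⟩ := hx
    constructor
    · refine not_lt.1 fun h => hx1 ?_
      rw [hB₁]; exact mem_filter.2 ⟨hx0, h⟩
    · refine not_lt.1 fun h => hx2 ?_
      rw [hB₂]; exact mem_filter.2 ⟨hx0, h⟩
  -- the path count from the neighbourhoods of a good vertex
  have hpath : ∀ x ∈ X 0 \ (B₁ ∪ B₂),
      (d / 2) ^ (n + 1) / 2 ^ n * #((X 1).filter (Γ.Adj x)) *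
        (∏ j ∈ range n, (#(shiftFam X (j + 1)) : ℝ)) * #((X L).filter (Γ.Adj x)) ≤
      #(pathSet Γ (n + 1) (shiftFam X) ((X 1).filter (Γ.Adj x)) ((X L).filter (Γ.Adj x))) := by
    intro x hx
    obtain ⟨h1, h2⟩ := hdeg x hx
    have hZ0 : shiftFam X 0 = X 1 := by
      rw [show (0 : ℕ) = ((0 : Fin (n + 2)) : ℕ) from rfl, shiftFam_eq]; rfl
    have hZL : shiftFam X (n + 1) = X L := by
      rw [show (n + 1 : ℕ) = ((Fin.last (n + 1)) : ℕ) from rfl, shiftFam_eq, hL, Fin.succ_last]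
    refine le_card_pathSet Γ hεd hd1 n (shiftFam X) _ _ (fun j hj => ?_) ?_ ?_ ?_ ?_
    · have hj1 : j + 1 < n + 3 := by omega
      have hj2 : j + 1 + 1 < n + 3 := by omega
      have e1 : shiftFam X j = X ⟨j + 1, hj1⟩ := by unfold shiftFam; rw [dif_pos hj1]
      have e2 : shiftFam X (j + 1) = X ⟨j + 1 + 1, hj2⟩ := by unfold shiftFam; rw [dif_pos hj2]
      have e3 : (⟨j + 1, hj1⟩ : Fin (n + 3)) + 1 = ⟨j + 1 + 1, hj2⟩ := by
        ext; rw [Fin.val_add_one_of_lt]; exact Fin.mk_lt_of_lt_val (by simp; omega)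
      rw [e1, e2, ← e3]
      exact hX _
    · rw [hZ0]; exact filter_subset _ _
    · rw [hZ0]; nlinarith [h1, Nat.cast_nonneg (α := ℝ) #(X 1)]
    · rw [hZL]; exact filter_subset _ _
    · rw [hZL]; nlinarith [h2, Nat.cast_nonneg (α := ℝ) #(X L), hε0]
  -- the injection into `cycSet`
  have hinj : ∑ x ∈ X 0 \ (B₁ ∪ B₂),
      #(pathSet Γ (n + 1) (shiftFam X) ((X 1).filter (Γ.Adj x)) ((X L).filter (Γ.Adj x))) ≤
      #(cycSet Γ X) := by
    classical
    calc ∑ x ∈ X 0 \ (B₁ ∪ B₂),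
          #(pathSet Γ (n + 1) (shiftFam X) ((X 1).filter (Γ.Adj x)) ((X L).filter (Γ.Adj x)))
        = ∑ x ∈ X 0 \ (B₁ ∪ B₂), #((pathSet Γ (n + 1) (shiftFam X) ((X 1).filter (Γ.Adj x))
            ((X L).filter (Γ.Adj x))).image (consV x)) := by
          refine sum_congr rfl fun x _ => ?_
          rw [card_image_of_injective _ (consV_injective x)]
      _ = #((X 0 \ (B₁ ∪ B₂)).biUnion fun x => (pathSet Γ (n + 1) (shiftFam X)
            ((X 1).filter (Γ.Adj x)) ((X L).filter (Γ.Adj x))).image (consV x)) := by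
          rw [card_biUnion]
          intro z _ z' _ hzz'
          rw [Function.onFun, Finset.disjoint_left]
          intro q hq hq'
          rw [mem_image] at hq hq'
          obtain ⟨p, -, rfl⟩ := hq
          obtain ⟨p', -, h⟩ := hq'
          apply hzz'
          have := congr_fun h 0
          simp only [consV_zero] at this
          exact this.symm
      _ ≤ #(cycSet Γ X) := by
          refine card_le_card fun q hq => ?_
          rw [mem_biUnion] at hq
          obtain ⟨x, hx, hq⟩ := hq
          rw [mem_image] at hq
          obtain ⟨p, hp, rfl⟩ := hq
          exact consV_mem_cycSet Γ (hGsub hx) hp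
  -- the product of the sizes
  have hprod : ∏ i, (#(X i) : ℝ) =
      #(X 0) * #(X 1) * (∏ j ∈ range n, (#(shiftFam X (j + 1)) : ℝ)) * #(X L) := by
    rw [Fin.prod_univ_succ, Fin.prod_univ_succ, Fin.prod_univ_castSucc]
    have : ∏ i : Fin n, (#(X i.castSucc.succ.succ) : ℝ) =
        ∏ j ∈ range n, (#(shiftFam X (j + 1)) : ℝ) := by
      rw [← Fin.prod_univ_eq_prod_range (fun j => (#(shiftFam X (j + 1)) : ℝ)) n]
      refine Fintype.prod_congr _ _ fun i => ?_
      have hi : (i : ℕ) + 1 + 1 < n + 3 := by omega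
      have e2 : shiftFam X (i + 1) = X ⟨i + 1 + 1, hi⟩ := by unfold shiftFam; rw [dif_pos hi]
      rw [e2]
      congr 2
    rw [this]
    have eL : (Fin.last n).succ.succ = L := by
      rw [hL]; ext; simp
    rw [eL]
    simp only [Fin.succ_zero_eq_one]
    ring
  -- assembling
  have hC : (0 : ℝ) ≤ (d / 2) ^ (n + 1) / 2 ^ n * ∏ j ∈ range n, (#(shiftFam X (j + 1)) : ℝ) :=
    mul_nonneg (div_nonneg (pow_nonneg (by linarith) _) (pow_nonneg (by norm_num) _))
      (prod_nonneg fun j _ => Nat.cast_nonneg _)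
  have hX1 : (0 : ℝ) ≤ #(X 1) := Nat.cast_nonneg _
  have hXL : (0 : ℝ) ≤ #(X L) := Nat.cast_nonneg _
  calc (d / 4) ^ (n + 3) * ∏ i, (#(X i) : ℝ)
      ≤ (d / 2) ^ (n + 3) / 2 ^ (n + 1) * ∏ i, (#(X i) : ℝ) := by
        apply mul_le_mul_of_nonneg_right _ (prod_nonneg fun i _ => Nat.cast_nonneg _)
        rw [show (d / 4) ^ (n + 3) = (d / 2) ^ (n + 3) / 2 ^ (n + 3) by
          rw [div_pow, div_pow, div_div, ← mul_pow]; norm_num]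
        apply div_le_div_of_nonneg_left (pow_nonneg (by linarith) _) (by positivity)
        exact pow_le_pow_right₀ (by norm_num) (by omega)
    _ = (#(X 0) / 2) * ((d / 2) * #(X 1)) * ((d / 2) * #(X L)) *
          ((d / 2) ^ (n + 1) / 2 ^ n * ∏ j ∈ range n, (#(shiftFam X (j + 1)) : ℝ)) := by
        rw [hprod]; ring
    _ ≤ #(X 0 \ (B₁ ∪ B₂)) * ((d - ε) * #(X 1)) * ((d - ε) * #(X L)) *
          ((d / 2) ^ (n + 1) / 2 ^ n * ∏ j ∈ range n, (#(shiftFam X (j + 1)) : ℝ)) := by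
        apply mul_le_mul_of_nonneg_right _ hC
        apply mul_le_mul _ _ (mul_nonneg (by linarith) hXL)
          (mul_nonneg (Nat.cast_nonneg _) (mul_nonneg (by linarith) hX1))
        · apply mul_le_mul hGcard _ (mul_nonneg (by linarith) hX1) (Nat.cast_nonneg _)
          exact mul_le_mul_of_nonneg_right (by linarith) hX1
        · exact mul_le_mul_of_nonneg_right (by linarith) hXL
    _ = ∑ x ∈ X 0 \ (B₁ ∪ B₂), ((d - ε) * #(X 1)) * ((d - ε) * #(X L)) *
          ((d / 2) ^ (n + 1) / 2 ^ n * ∏ j ∈ range n, (#(shiftFam X (j + 1)) : ℝ)) := by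
        rw [sum_const, nsmul_eq_mul]; ring
    _ ≤ ∑ x ∈ X 0 \ (B₁ ∪ B₂), (#((X 1).filter (Γ.Adj x)) : ℝ) * #((X L).filter (Γ.Adj x)) *
          ((d / 2) ^ (n + 1) / 2 ^ n * ∏ j ∈ range n, (#(shiftFam X (j + 1)) : ℝ)) := by
        refine sum_le_sum fun x hx => ?_
        obtain ⟨h1, h2⟩ := hdeg x hx
        apply mul_le_mul_of_nonneg_right _ hC
        exact mul_le_mul h1 h2 (mul_nonneg (by linarith) hXL) (Nat.cast_nonneg _)
    _ ≤ ∑ x ∈ X 0 \ (B₁ ∪ B₂), (#(pathSet Γ (n + 1) (shiftFam X) ((X 1).filter (Γ.Adj x))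
          ((X L).filter (Γ.Adj x))) : ℝ) := by
        refine sum_le_sum fun x hx => ?_
        have := hpath x hx
        calc _ = (d / 2) ^ (n + 1) / 2 ^ n * #((X 1).filter (Γ.Adj x)) *
            (∏ j ∈ range n, (#(shiftFam X (j + 1)) : ℝ)) * #((X L).filter (Γ.Adj x)) := by ring
          _ ≤ _ := this
    _ ≤ #(cycSet Γ X) := by exact_mod_cast hinj

end Paths

/-! ### Slicing uniform pairs -/

section Slicing

/-- **Slicing lemma.** Large subsets (relative size `≥ α ≥ ε`, `α ≤ 1/2`) of an `ε`-uniform pair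
form an `ε/α`-uniform pair whose density dropped by less than `ε`. [folklore] -/
theorem isUniform_slice {ε α : ℝ} {U W X Y : Finset V} (hU : Γ.IsUniform ε U W) (hXU : X ⊆ U)
    (hYW : Y ⊆ W) (hεα : ε ≤ α) (hα : α ≤ 1 / 2) (hX : α * #U ≤ #X) (hY : α * #W ≤ #Y) :
    Γ.IsUniform (ε / α) X Y ∧ (Γ.edgeDensity U W : ℝ) - ε ≤ Γ.edgeDensity X Y := by
  have hε0 : 0 < ε := hU.pos
  have hα0 : 0 < α := lt_of_lt_of_le hε0 hεα
  have hXY : |(Γ.edgeDensity X Y : ℝ) - Γ.edgeDensity U W| < ε :=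
    hU hXU hYW (by nlinarith [Nat.cast_nonneg (α := ℝ) #U])
      (by nlinarith [Nat.cast_nonneg (α := ℝ) #W])
  refine ⟨fun X' hX' Y' hY' hX'c hY'c => ?_, ?_⟩
  · have h1 : (#U : ℝ) * ε ≤ #X' := by
      have : ε * #U ≤ ε / α * (α * #U) := by field_simp; rfl
      have h2 : ε / α * (α * #U) ≤ ε / α * #X :=
        mul_le_mul_of_nonneg_left hX (div_nonneg hε0.le hα0.le)
      linarith
    have h2 : (#W : ℝ) * ε ≤ #Y' := by
      have : ε * #W ≤ ε / α * (α * #W) := by field_simp; rfl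
      have h2 : ε / α * (α * #W) ≤ ε / α * #Y :=
        mul_le_mul_of_nonneg_left hY (div_nonneg hε0.le hα0.le)
      linarith
    have hX'Y' : |(Γ.edgeDensity X' Y' : ℝ) - Γ.edgeDensity U W| < ε :=
      hU (hX'.trans hXU) (hY'.trans hYW) h1 h2
    have h3 : 2 * ε ≤ ε / α := by
      rw [le_div_iff₀ hα0]; nlinarith
    calc |(Γ.edgeDensity X' Y' : ℝ) - Γ.edgeDensity X Y|
        = |((Γ.edgeDensity X' Y' : ℝ) - Γ.edgeDensity U W) -
            ((Γ.edgeDensity X Y : ℝ) - Γ.edgeDensity U W)| := by ring_nf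
      _ ≤ |(Γ.edgeDensity X' Y' : ℝ) - Γ.edgeDensity U W| +
            |(Γ.edgeDensity X Y : ℝ) - Γ.edgeDensity U W| := abs_sub _ _
      _ < ε + ε := add_lt_add hX'Y' hXY
      _ = 2 * ε := by ring
      _ ≤ ε / α := h3
  · rw [abs_sub_lt_iff] at hXY
    linarith [hXY.2]

end Slicing

/-! ### The removal lemma for cycles through the layers of `Fin k × β` -/

section Removal

open SzemerediRegularity

variable {W : Type*} [DecidableEq W] [Fintype W] (G : SimpleGraph W) [DecidableRel G.Adj]

omit Γ [DecidableRel Γ.Adj] in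
/-- The edges of `G` lost in the reduced graph lie in a non-uniform pair, inside a part, or in a
sparse pair (Mathlib's `unreduced_edges_subset` with decoupled parameters). [folklore] -/
theorem unreduced_edges_subset' (P : Finpartition (univ : Finset W)) (ε₀ η : ℝ) :
    (univ.filter fun e : W × W => G.Adj e.1 e.2 ∧ ¬ (G.regularityReduced P ε₀ η).Adj e.1 e.2) ⊆
      ((P.nonUniforms G ε₀).biUnion fun UV => UV.1 ×ˢ UV.2) ∪ P.parts.biUnion offDiag ∪
        (P.sparsePairs G η).biUnion fun UV => G.interedges UV.1 UV.2 := by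
  rintro ⟨x, y⟩
  simp only [mem_filter, mem_univ, true_and, SimpleGraph.regularityReduced_adj, not_and,
    not_exists, not_le, mem_biUnion, mem_union, mem_product, Prod.exists, mem_offDiag, and_imp,
    or_assoc, and_assoc, P.mk_mem_nonUniforms, Finpartition.mk_mem_sparsePairs,
    SimpleGraph.mem_interedges_iff]
  intro h h'
  replace h' := h' h
  obtain ⟨U, hU, hx⟩ := P.exists_mem (mem_univ x)
  obtain ⟨U', hU', hy⟩ := P.exists_mem (mem_univ y)
  obtain rfl | hUV := eq_or_ne U U'
  · exact Or.inr (Or.inl ⟨U, hU, hx, hy, G.ne_of_adj h⟩)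
  by_cases h₂ : G.IsUniform ε₀ U U'
  · exact Or.inr <| Or.inr ⟨U, U', hU, hU', hUV, h' _ hU _ hU' hx hy hUV h₂, hx, hy, h⟩
  · exact Or.inl ⟨U, U', hU, hU', hUV, h₂, hx, hy⟩

omit Γ [DecidableRel Γ.Adj] in
/-- The number of (ordered) edges lost in the reduced graph. [folklore] -/
theorem card_unreduced_le [Nonempty W] {P : Finpartition (univ : Finset W)} {ε₀ η ε₁ : ℝ}
    (hP : P.IsEquipartition) (hPU : P.IsUniform G ε₀) (hε₀ : 0 < ε₀) (hη : 0 ≤ η)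
    (hε₁ : 0 < ε₁) (hparts : 4 / ε₁ ≤ #P.parts) :
    (#(univ.filter fun e : W × W =>
        G.Adj e.1 e.2 ∧ ¬ (G.regularityReduced P ε₀ η).Adj e.1 e.2) : ℝ) ≤
      (4 * ε₀ + ε₁ / 2 + 4 * η) * (Fintype.card W) ^ 2 := by
  have hA : (#(univ : Finset W) : ℝ) = Fintype.card W := by rw [Finset.card_univ]
  calc (#(univ.filter fun e : W × W =>
        G.Adj e.1 e.2 ∧ ¬ (G.regularityReduced P ε₀ η).Adj e.1 e.2) : ℝ)
      ≤ #(((P.nonUniforms G ε₀).biUnion fun UV => UV.1 ×ˢ UV.2) ∪ P.parts.biUnion offDiag ∪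
          (P.sparsePairs G η).biUnion fun UV => G.interedges UV.1 UV.2) := by
        exact_mod_cast card_le_card (unreduced_edges_subset' G P ε₀ η)
    _ ≤ #((P.nonUniforms G ε₀).biUnion fun UV => UV.1 ×ˢ UV.2) + #(P.parts.biUnion offDiag) +
          #((P.sparsePairs G η).biUnion fun UV => G.interedges UV.1 UV.2) := by
        exact_mod_cast (card_union_le _ _).trans (Nat.add_le_add_right (card_union_le _ _) _)
    _ ≤ 4 * ε₀ * #(univ : Finset W) ^ 2 + ε₁ / 2 * #(univ : Finset W) ^ 2 +
          4 * η * #(univ : Finset W) ^ 2 := by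
        gcongr
        · exact (hP.sum_nonUniforms_lt univ_nonempty hε₀ hPU).le
        · exact hP.card_biUnion_offDiag_le hε₁ hparts
        · exact hP.card_interedges_sparsePairs_le hη
    _ = (4 * ε₀ + ε₁ / 2 + 4 * η) * (Fintype.card W) ^ 2 := by rw [hA]; ring

omit Γ [DecidableRel Γ.Adj] [DecidableRel G.Adj] in
/-- Parts of an equipartition with at most `b` parts have at least `|W| / (2b)` elements
(Mathlib's private `card_bound`). [folklore] -/
theorem card_part_ge {P : Finpartition (univ : Finset W)} (hP : P.IsEquipartition) {b : ℕ}
    (hb : #P.parts ≤ b) {U : Finset W} (hU : U ∈ P.parts) :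
    (Fintype.card W : ℝ) / (2 * b) ≤ #U := by
  have hpos : 0 < #P.parts := Finset.card_pos.2 ⟨_, hU⟩
  have hle : #P.parts ≤ Fintype.card W := by
    simpa using P.card_parts_le_card
  have h1 : (Fintype.card W : ℝ) / (2 * b) ≤ Fintype.card W / (2 * #P.parts : ℝ) := by
    apply div_le_div_of_nonneg_left (Nat.cast_nonneg _) (by positivity)
    gcongr
  have h2 : Fintype.card W < 2 * #P.parts * (Fintype.card W / #P.parts) := by
    have hmod := Nat.mod_add_div (Fintype.card W) #P.parts
    have hlt := Nat.mod_lt (Fintype.card W) hpos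
    have hdiv : 1 ≤ Fintype.card W / #P.parts := (Nat.one_le_div_iff hpos).2 hle
    nlinarith
  have h3 : (Fintype.card W : ℝ) / (2 * #P.parts : ℝ) ≤ ((Fintype.card W / #P.parts : ℕ) : ℝ) := by
    rw [div_le_iff₀ (by positivity)]
    have : (Fintype.card W : ℝ) ≤ 2 * #P.parts * ((Fintype.card W / #P.parts : ℕ) : ℝ) := by
      exact_mod_cast h2.le
    linarith
  have h4 : ((Fintype.card W / #P.parts : ℕ) : ℝ) ≤ #U := by
    have := hP.average_le_card_part hU
    rw [Finset.card_univ] at this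
    exact_mod_cast this
  linarith

/-! #### Layered graphs on `Fin k × β` -/

variable {β : Type*} [Fintype β] [DecidableEq β]

omit Γ [DecidableRel Γ.Adj] G [DecidableRel G.Adj] [DecidableEq W] [Fintype W] in
/-- The "around" `k`-tuples of a graph on `Fin k × β`: `y : Fin k → β` with
`(i, y i) ∼ (i+1, y (i+1))` for all `i` (indices mod `k`). [folklore] -/
def aroundSet {n : ℕ} (Γ : SimpleGraph (Fin (n + 1) × β)) [DecidableRel Γ.Adj] :
    Finset (Fin (n + 1) → β) :=
  univ.filter fun y => ∀ i, Γ.Adj (i, y i) (i + 1, y (i + 1))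

omit Γ [DecidableRel Γ.Adj] G [DecidableRel G.Adj] [DecidableEq W] in
/-- The ordered pairs adjacent in `Γ` but not in `Γ'` ("removed edges", each counted twice).
[folklore] -/
def removedPairs (Γ Γ' : SimpleGraph W) [DecidableRel Γ.Adj] [DecidableRel Γ'.Adj] :
    Finset (W × W) :=
  univ.filter fun e => Γ.Adj e.1 e.2 ∧ ¬ Γ'.Adj e.1 e.2

omit Γ [DecidableRel Γ.Adj] G [DecidableRel G.Adj] [DecidableEq W] [Fintype W] [Fintype β]
  [DecidableEq β] in
/-- The part of `U ⊆ Fin k × β` in layer `i`. [folklore] -/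
def layerPiece {n : ℕ} (U : Finset (Fin (n + 1) × β)) (i : Fin (n + 1)) :
    Finset (Fin (n + 1) × β) :=
  U.filter fun w => w.1 = i

/-- The cleaned graph: keep an edge of `Γ` if it joins two distinct parts of `P` forming an
`ε₀`-uniform pair of density `≥ η`, and both endpoints are *good*, i.e. lie in a part in which
their own layer occupies a proportion `≥ α`. [folklore] -/
def cleaned {n : ℕ} (Γ : SimpleGraph (Fin (n + 1) × β)) [DecidableRel Γ.Adj]
    (P : Finpartition (univ : Finset (Fin (n + 1) × β))) (ε₀ η α : ℝ) :
    SimpleGraph (Fin (n + 1) × β) where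
  Adj v w := (Γ.regularityReduced P ε₀ η).Adj v w ∧
    α * #(P.part v) ≤ #(layerPiece (P.part v) v.1) ∧ α * #(P.part w) ≤ #(layerPiece (P.part w) w.1)
  symm := ⟨fun _ _ h => ⟨h.1.symm, h.2.2, h.2.1⟩⟩
  loopless := ⟨fun _ h => h.1.1.ne rfl⟩

omit Γ [DecidableRel Γ.Adj] G [DecidableRel G.Adj] [DecidableEq W] [Fintype W] in
/-- Few vertices are bad: in each part, the layers occupying a proportion `< α` of it contain
fewer than `kα` times its size. [folklore] -/
theorem card_badVert_le {n : ℕ} (P : Finpartition (univ : Finset (Fin (n + 1) × β))) {α : ℝ}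
    (hα : 0 ≤ α) :
    (#(univ.filter fun v : Fin (n + 1) × β =>
        ¬ (α * #(P.part v) ≤ #(layerPiece (P.part v) v.1))) : ℝ) ≤
      (n + 1) * α * Fintype.card (Fin (n + 1) × β) := by
  classical
  have hsub : (univ.filter fun v : Fin (n + 1) × β =>
      ¬ (α * #(P.part v) ≤ #(layerPiece (P.part v) v.1))) ⊆ P.parts.biUnion fun U =>
      ((univ : Finset (Fin (n + 1))).filter fun i => (#(layerPiece U i) : ℝ) < α * #U).biUnion
        fun i => layerPiece U i := by
    intro v hv
    rw [mem_filter] at hv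
    rw [mem_biUnion]
    refine ⟨P.part v, P.part_mem.2 (mem_univ v), ?_⟩
    rw [mem_biUnion]
    exact ⟨v.1, mem_filter.2 ⟨mem_univ _, not_le.1 hv.2⟩,
      mem_filter.2 ⟨P.mem_part (mem_univ v), rfl⟩⟩
  calc (#(univ.filter fun v : Fin (n + 1) × β =>
        ¬ (α * #(P.part v) ≤ #(layerPiece (P.part v) v.1))) : ℝ)
      ≤ #(P.parts.biUnion fun U => ((univ : Finset (Fin (n + 1))).filter fun i =>
          (#(layerPiece U i) : ℝ) < α * #U).biUnion fun i => layerPiece U i) := by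
        exact_mod_cast card_le_card hsub
    _ ≤ ∑ U ∈ P.parts, (#(((univ : Finset (Fin (n + 1))).filter fun i =>
          (#(layerPiece U i) : ℝ) < α * #U).biUnion fun i => layerPiece U i) : ℝ) := by
        exact_mod_cast card_biUnion_le
    _ ≤ ∑ U ∈ P.parts, ∑ i ∈ (univ : Finset (Fin (n + 1))).filter
          (fun i => (#(layerPiece U i) : ℝ) < α * #U), (#(layerPiece U i) : ℝ) := by
        refine sum_le_sum fun U _ => ?_
        exact_mod_cast card_biUnion_le
    _ ≤ ∑ U ∈ P.parts, ∑ i ∈ (univ : Finset (Fin (n + 1))).filter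
          (fun i => (#(layerPiece U i) : ℝ) < α * #U), α * #U :=
        sum_le_sum fun U _ => sum_le_sum fun i hi => ((mem_filter.1 hi).2).le
    _ ≤ ∑ U ∈ P.parts, (n + 1) * (α * #U) := by
        refine sum_le_sum fun U _ => ?_
        rw [sum_const, nsmul_eq_mul]
        have h1 : (#((univ : Finset (Fin (n + 1))).filter
            (fun i => (#(layerPiece U i) : ℝ) < α * #U)) : ℝ) ≤ n + 1 := by
          have := card_filter_le (univ : Finset (Fin (n + 1)))
            (fun i => (#(layerPiece U i) : ℝ) < α * #U)
          rw [card_univ, Fintype.card_fin] at this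
          exact_mod_cast this
        exact mul_le_mul_of_nonneg_right h1 (by positivity)
    _ = (n + 1) * α * ∑ U ∈ P.parts, (#U : ℝ) := by
        rw [mul_sum]
        exact sum_congr rfl fun U _ => by ring
    _ = (n + 1) * α * Fintype.card (Fin (n + 1) × β) := by
        rw [← Finset.card_univ, ← P.sum_card_parts]
        push_cast
        ring

omit Γ [DecidableRel Γ.Adj] G [DecidableRel G.Adj] [DecidableEq W] [Fintype W] [DecidableEq β] in
/-- Tuples of `cycSet` through layer-pure sets are around tuples. [folklore] -/
theorem card_cycSet_le_card_aroundSet {n : ℕ} (Γ : SimpleGraph (Fin (n + 1) × β))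
    [DecidableRel Γ.Adj] (X : Fin (n + 1) → Finset (Fin (n + 1) × β))
    (hX : ∀ i, ∀ v ∈ X i, v.1 = i) : #(cycSet Γ X) ≤ #(aroundSet Γ) := by
  refine card_le_card_of_injOn (fun x => fun i => (x i).2) (fun x hx => ?_) ?_
  · rw [mem_coe, mem_cycSet] at hx
    rw [mem_coe, aroundSet, mem_filter]
    refine ⟨mem_univ _, fun i => ?_⟩
    have e1 : x i = (i, (x i).2) := Prod.ext (hX i _ (hx.1 i)) rfl
    have e2 : x (i + 1) = (i + 1, (x (i + 1)).2) := Prod.ext (hX (i + 1) _ (hx.1 (i + 1))) rfl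
    rw [← e1, ← e2]
    exact hx.2 i
  · intro x hx x' hx' h
    rw [mem_coe, mem_cycSet] at hx hx'
    funext i
    have h2 : (x i).2 = (x' i).2 := congr_fun h i
    exact Prod.ext ((hX i _ (hx.1 i)).trans (hX i _ (hx'.1 i)).symm) h2

/-- Classical decidability of adjacency in the cleaned graph (the definition involves real
inequalities). [folklore] -/
noncomputable instance cleaned.instDecidableRelAdj {n : ℕ} (Γ : SimpleGraph (Fin (n + 1) × β))
    [DecidableRel Γ.Adj] (P : Finpartition (univ : Finset (Fin (n + 1) × β))) (ε₀ η α : ℝ) :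
    DecidableRel (cleaned Γ P ε₀ η α).Adj :=
  Classical.decRel _

omit Γ [DecidableRel Γ.Adj] G [DecidableRel G.Adj] [DecidableEq W] [Fintype W] in
/-- The cleaning removes few (ordered) edges. [folklore] -/
theorem card_removedPairs_cleaned_le {n : ℕ} [Nonempty (Fin (n + 1) × β)]
    (Γ : SimpleGraph (Fin (n + 1) × β)) [DecidableRel Γ.Adj]
    (P : Finpartition (univ : Finset (Fin (n + 1) × β))) {ε₀ η ε₁ α : ℝ}
    (hP₁ : P.IsEquipartition) (hP₄ : P.IsUniform Γ ε₀) (hε₀ : 0 < ε₀) (hη : 0 ≤ η)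
    (hε₁ : 0 < ε₁) (hparts : 4 / ε₁ ≤ #P.parts) (hα : 0 ≤ α) :
    (#(removedPairs Γ (cleaned Γ P ε₀ η α)) : ℝ) ≤
      (4 * ε₀ + ε₁ / 2 + 4 * η) * (Fintype.card (Fin (n + 1) × β)) ^ 2 +
        2 * (((n : ℝ) + 1) * α * Fintype.card (Fin (n + 1) × β)) *
          Fintype.card (Fin (n + 1) × β) := by
  have hsub : removedPairs Γ (cleaned Γ P ε₀ η α) ⊆
      (univ.filter fun e : (Fin (n + 1) × β) × (Fin (n + 1) × β) =>
        Γ.Adj e.1 e.2 ∧ ¬ (Γ.regularityReduced P ε₀ η).Adj e.1 e.2) ∪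
      (univ.filter fun v : Fin (n + 1) × β =>
        ¬ (α * #(P.part v) ≤ #(layerPiece (P.part v) v.1))) ×ˢ univ ∪
      univ ×ˢ (univ.filter fun v : Fin (n + 1) × β =>
        ¬ (α * #(P.part v) ≤ #(layerPiece (P.part v) v.1))) := by
    intro e he
    rw [removedPairs, mem_filter] at he
    obtain ⟨-, hadj, hnot⟩ := he
    simp only [mem_union, mem_filter, mem_univ, true_and, mem_product, and_true]
    by_cases h1 : (Γ.regularityReduced P ε₀ η).Adj e.1 e.2
    · by_cases h2 : α * #(P.part e.1) ≤ #(layerPiece (P.part e.1) e.1.1)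
      · right
        intro h3
        exact hnot ⟨h1, h2, h3⟩
      · left; right; exact h2
    · left; left; exact ⟨hadj, h1⟩
  have hbad := card_badVert_le P hα (n := n)
  have hunred := card_unreduced_le Γ hP₁ hP₄ hε₀ hη hε₁ hparts
  calc (#(removedPairs Γ (cleaned Γ P ε₀ η α)) : ℝ)
      ≤ #((univ.filter fun e : (Fin (n + 1) × β) × (Fin (n + 1) × β) =>
          Γ.Adj e.1 e.2 ∧ ¬ (Γ.regularityReduced P ε₀ η).Adj e.1 e.2) ∪
        (univ.filter fun v : Fin (n + 1) × β =>
          ¬ (α * #(P.part v) ≤ #(layerPiece (P.part v) v.1))) ×ˢ univ) +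
        #(univ ×ˢ (univ.filter fun v : Fin (n + 1) × β =>
          ¬ (α * #(P.part v) ≤ #(layerPiece (P.part v) v.1)))) := by
        exact_mod_cast (card_le_card hsub).trans (card_union_le _ _)
    _ ≤ #(univ.filter fun e : (Fin (n + 1) × β) × (Fin (n + 1) × β) =>
          Γ.Adj e.1 e.2 ∧ ¬ (Γ.regularityReduced P ε₀ η).Adj e.1 e.2) +
        #((univ.filter fun v : Fin (n + 1) × β =>
          ¬ (α * #(P.part v) ≤ #(layerPiece (P.part v) v.1))) ×ˢ
            (univ : Finset (Fin (n + 1) × β))) +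
        #((univ : Finset (Fin (n + 1) × β)) ×ˢ (univ.filter fun v : Fin (n + 1) × β =>
          ¬ (α * #(P.part v) ≤ #(layerPiece (P.part v) v.1)))) := by
        exact_mod_cast Nat.add_le_add_right (card_union_le _ _) _
    _ ≤ (4 * ε₀ + ε₁ / 2 + 4 * η) * (Fintype.card (Fin (n + 1) × β)) ^ 2 +
        ((n : ℝ) + 1) * α * Fintype.card (Fin (n + 1) × β) * Fintype.card (Fin (n + 1) × β) +
        Fintype.card (Fin (n + 1) × β) * (((n : ℝ) + 1) * α * Fintype.card (Fin (n + 1) × β)) := by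
        rw [card_product, card_product, card_univ]
        push_cast
        gcongr
    _ = _ := by ring

omit Γ [DecidableRel Γ.Adj] G [DecidableRel G.Adj] [DecidableEq W] [Fintype W] in
/-- If the cleaned graph had an around tuple, the original graph would have many: at least
`(η/8)^k (α |V| / (2b))^k` where `b` bounds the number of parts. [folklore] -/
theorem le_card_aroundSet_of_mem_cleaned {n : ℕ} (Γ : SimpleGraph (Fin (n + 3) × β))
    [DecidableRel Γ.Adj] (P : Finpartition (univ : Finset (Fin (n + 3) × β))) {ε₀ η α : ℝ}
    {b : ℕ} (hP₁ : P.IsEquipartition) (hP₃ : #P.parts ≤ b) (hε₀α : ε₀ ≤ α) (hα2 : α ≤ 1 / 2)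
    (hα0 : 0 ≤ α) (hε₀η : ε₀ ≤ η / 2) (hη1 : η ≤ 1) (hquot : ε₀ / α = η / 2 / 4)
    {y : Fin (n + 3) → β} (hy : y ∈ aroundSet (cleaned Γ P ε₀ η α)) :
    (η / 2 / 4) ^ (n + 3) * (α * (Fintype.card (Fin (n + 3) × β) / (2 * b))) ^ (n + 3) ≤
      #(aroundSet Γ) := by
  rw [aroundSet, mem_filter] at hy
  obtain ⟨-, hy⟩ := hy
  -- the parts through which the tuple passes
  have hpart : ∀ i, Γ.IsUniform ε₀ (P.part (i, y i)) (P.part (i + 1, y (i + 1))) ∧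
      η ≤ Γ.edgeDensity (P.part (i, y i)) (P.part (i + 1, y (i + 1))) ∧
      α * #(P.part (i, y i)) ≤ #(layerPiece (P.part (i, y i)) i) := by
    intro i
    obtain ⟨⟨-, U, hU, U', hU', hv, hw, -, huni, hdens⟩, hgood, -⟩ := hy i
    rw [P.part_eq_of_mem hU hv, P.part_eq_of_mem hU' hw]
    refine ⟨huni, hdens, ?_⟩
    rw [P.part_eq_of_mem hU hv] at hgood
    exact hgood
  obtain ⟨X, hXdef⟩ : ∃ X : Fin (n + 3) → Finset (Fin (n + 3) × β),
      X = fun i => layerPiece (P.part (i, y i)) i := ⟨_, rfl⟩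
  have hXlayer : ∀ i, ∀ v ∈ X i, v.1 = i := fun i v hv => by
    rw [hXdef] at hv; exact (mem_filter.1 hv).2
  have hXsub : ∀ i, X i ⊆ P.part (i, y i) := fun i => by rw [hXdef]; exact filter_subset _ _
  have hXgood : ∀ i, α * #(P.part (i, y i)) ≤ #(X i) := fun i => by rw [hXdef]; exact (hpart i).2.2
  have hXunif : ∀ i, Γ.IsUniform (η / 2 / 4) (X i) (X (i + 1)) ∧
      η / 2 ≤ Γ.edgeDensity (X i) (X (i + 1)) := by
    intro i
    obtain ⟨huni, hdens, -⟩ := hpart i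
    obtain ⟨h1, h2⟩ := isUniform_slice Γ huni (hXsub i) (hXsub (i + 1)) hε₀α hα2
      (hXgood i) (hXgood (i + 1))
    refine ⟨?_, by linarith⟩
    rw [← hquot]; exact h1
  have hcount := le_card_cycSet Γ (ε := η / 2 / 4) (d := η / 2) (by linarith) (by linarith)
    X hXunif
  have hcyc := card_cycSet_le_card_aroundSet Γ X hXlayer
  have hsize : ∀ i, α * (Fintype.card (Fin (n + 3) × β) / (2 * b)) ≤ #(X i) := by
    intro i
    have h1 := card_part_ge hP₁ hP₃ (P.part_mem.2 (mem_univ (i, y i)))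
    exact (mul_le_mul_of_nonneg_left h1 hα0).trans (hXgood i)
  have hη0 : 0 ≤ η := by
    have := (hXunif 0).1.pos
    linarith
  calc (η / 2 / 4) ^ (n + 3) * (α * (Fintype.card (Fin (n + 3) × β) / (2 * b))) ^ (n + 3)
      = (η / 2 / 4) ^ (n + 3) *
          ∏ _i : Fin (n + 3), (α * (Fintype.card (Fin (n + 3) × β) / (2 * b))) := by
        rw [prod_const, card_univ, Fintype.card_fin]
    _ ≤ (η / 2 / 4) ^ (n + 3) * ∏ i, (#(X i) : ℝ) := by
        apply mul_le_mul_of_nonneg_left _ (by positivity)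
        exact prod_le_prod (fun i _ => by positivity) fun i _ => hsize i
    _ ≤ #(cycSet Γ X) := hcount
    _ ≤ #(aroundSet Γ) := by exact_mod_cast hcyc

omit Γ [DecidableRel Γ.Adj] G [DecidableRel G.Adj] [DecidableEq W] [Fintype W] in
/-- **Removal lemma for around cycles** in graphs on `Fin k × β` (`k = n + 3 ≥ 3`): if there
are at most `δ |β|^k` around `k`-tuples, one can delete at most `ε |β|²` (ordered) edges so that
no around tuple survives. Proof: Szemerédi's regularity lemma (Mathlib), cleaning, slicing by
layers, and the cycle counting lemma `le_card_cycSet`. [folklore] -/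
theorem around_cycle_removal (n : ℕ) {ε : ℝ} (hε : 0 < ε) (hε1 : ε ≤ 1) : ∃ δ : ℝ, 0 < δ ∧
    ∀ (β : Type*) [Fintype β] [DecidableEq β] (Γ : SimpleGraph (Fin (n + 3) × β))
      [DecidableRel Γ.Adj], (#(aroundSet Γ) : ℝ) ≤ δ * (Fintype.card β) ^ (n + 3) →
      ∃ (Γ' : SimpleGraph (Fin (n + 3) × β)) (_ : DecidableRel Γ'.Adj), Γ' ≤ Γ ∧
        (#(removedPairs Γ Γ') : ℝ) ≤ ε * (Fintype.card β) ^ 2 ∧ aroundSet Γ' = ∅ := by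
  -- the constants
  obtain ⟨k, hk⟩ : ∃ k : ℕ, k = n + 3 := ⟨_, rfl⟩
  have hk3 : (3 : ℝ) ≤ k := by rw [hk]; push_cast; linarith
  have hk0 : (0 : ℝ) < k := by linarith
  obtain ⟨η, hη⟩ : ∃ η : ℝ, η = ε / (16 * k ^ 2) := ⟨_, rfl⟩
  obtain ⟨ε₁, hε₁⟩ : ∃ ε₁ : ℝ, ε₁ = ε / (2 * k ^ 2) := ⟨_, rfl⟩
  obtain ⟨α, hα⟩ : ∃ α : ℝ, α = ε / (16 * k ^ 3) := ⟨_, rfl⟩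
  obtain ⟨ε₀, hε₀⟩ : ∃ ε₀ : ℝ, ε₀ = α * η / 8 := ⟨_, rfl⟩
  have hηpos : 0 < η := by rw [hη]; positivity
  have hε₁pos : 0 < ε₁ := by rw [hε₁]; positivity
  have hαpos : 0 < α := by rw [hα]; positivity
  have hε₀pos : 0 < ε₀ := by rw [hε₀]; positivity
  have hk2 : (9 : ℝ) ≤ k ^ 2 := by nlinarith
  have hk3' : (27 : ℝ) ≤ k ^ 3 := by nlinarith
  have hηle : η ≤ 1 / 16 := by
    rw [hη, div_le_iff₀ (by positivity)]; nlinarith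
  have hαle : α ≤ 1 / 16 := by
    rw [hα, div_le_iff₀ (by positivity)]; nlinarith
  have hε₀α : ε₀ ≤ α := by
    rw [hε₀]; nlinarith
  have hε₀η : ε₀ ≤ η / 2 := by
    rw [hε₀]; nlinarith
  have hquot : ε₀ / α = η / 2 / 4 := by
    have hα0 : α ≠ 0 := hαpos.ne'
    rw [hε₀]; field_simp; ring
  obtain ⟨l, hl⟩ : ∃ l : ℕ, l = ⌈4 / ε₁⌉₊ := ⟨_, rfl⟩
  have hlpos : 0 < l := by rw [hl]; exact Nat.ceil_pos.2 (by positivity)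
  have hl4 : 4 / ε₁ ≤ l := by rw [hl]; exact Nat.le_ceil _
  obtain ⟨b, hb⟩ : ∃ b : ℕ, b = SzemerediRegularity.bound ε₀ l := ⟨_, rfl⟩
  have hbpos : 0 < b := by rw [hb]; exact SzemerediRegularity.bound_pos _ _
  obtain ⟨c, hc⟩ : ∃ c : ℝ, c = (η / 2 / 4) ^ (n + 3) * (α * (k / (2 * b))) ^ (n + 3) :=
    ⟨_, rfl⟩
  have hcpos : 0 < c := by rw [hc]; positivity
  refine ⟨min (1 / (2 * (l : ℝ) ^ (n + 3))) (c / 2), by positivity, ?_⟩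
  intro β _ _ Γ _ hfew
  have hcardV : (Fintype.card (Fin (n + 3) × β) : ℝ) = k * Fintype.card β := by
    rw [Fintype.card_prod, Fintype.card_fin, hk]; push_cast; ring
  by_cases hsmall : Fintype.card (Fin (n + 3) × β) < l
  · -- tiny vertex set: there is no around tuple at all
    refine ⟨Γ, inferInstance, le_rfl, ?_, ?_⟩
    · have : removedPairs Γ Γ = ∅ := by
        rw [removedPairs, filter_eq_empty_iff]
        intro e _ h
        exact h.2 h.1
      rw [this, Finset.card_empty, Nat.cast_zero]
      positivity
    · have hN : (Fintype.card β : ℝ) < l := by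
        have h1 : Fintype.card β ≤ Fintype.card (Fin (n + 3) × β) := by
          rw [Fintype.card_prod, Fintype.card_fin]; nlinarith
        exact_mod_cast h1.trans_lt hsmall
      have h2 : (Fintype.card β : ℝ) ^ (n + 3) < (l : ℝ) ^ (n + 3) :=
        pow_lt_pow_left₀ hN (Nat.cast_nonneg _) (by omega)
      have h3 : (#(aroundSet Γ) : ℝ) < 1 := by
        calc (#(aroundSet Γ) : ℝ) ≤ min (1 / (2 * (l : ℝ) ^ (n + 3))) (c / 2) *
              (Fintype.card β) ^ (n + 3) := hfew
          _ ≤ 1 / (2 * (l : ℝ) ^ (n + 3)) * (Fintype.card β) ^ (n + 3) :=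
              mul_le_mul_of_nonneg_right (min_le_left _ _) (by positivity)
          _ ≤ 1 / (2 * (l : ℝ) ^ (n + 3)) * (l : ℝ) ^ (n + 3) :=
              mul_le_mul_of_nonneg_left h2.le (by positivity)
          _ = 1 / 2 := by field_simp
          _ < 1 := by norm_num
      have h4 : #(aroundSet Γ) = 0 := by
        have : (#(aroundSet Γ) : ℝ) < (1 : ℕ) := by exact_mod_cast h3
        exact Nat.lt_one_iff.1 (by exact_mod_cast this)
      exact card_eq_zero.1 h4
  -- the main case: regularity
  push Not at hsmall
  have hNpos : 0 < Fintype.card β := by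
    rw [Fintype.card_prod, Fintype.card_fin] at hsmall
    rcases Nat.eq_zero_or_pos (Fintype.card β) with h0 | h0
    · rw [h0, mul_zero] at hsmall; omega
    · exact h0
  haveI : Nonempty (Fin (n + 3) × β) := by
    rw [← Fintype.card_pos_iff, Fintype.card_prod, Fintype.card_fin]; positivity
  obtain ⟨P, hP₁, hP₂, hP₃, hP₄⟩ := szemeredi_regularity Γ hε₀pos hsmall
  rw [← hb] at hP₃
  have hparts : 4 / ε₁ ≤ #P.parts := hl4.trans (by exact_mod_cast hP₂)
  refine ⟨cleaned Γ P ε₀ η α, inferInstance, fun v w h => h.1.1, ?_, ?_⟩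
  · -- few removed pairs
    have h1 := card_removedPairs_cleaned_le Γ P hP₁ hP₄ hε₀pos hηpos.le hε₁pos hparts hαpos.le
    rw [hcardV] at h1
    refine h1.trans ?_
    have h2 : ((n + 2 : ℕ) : ℝ) + 1 = k := by rw [hk]; push_cast; ring
    rw [h2]
    have e1 : (k : ℝ) ^ 2 * (ε₁ / 2) = ε / 4 := by
      rw [hε₁]; field_simp; norm_num
    have e2 : (k : ℝ) ^ 2 * (4 * η) = ε / 4 := by
      rw [hη]; field_simp; norm_num
    have e3 : 2 * (k : ℝ) ^ 3 * α = ε / 8 := by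
      rw [hα]; field_simp; norm_num
    have e4 : (k : ℝ) ^ 2 * (4 * ε₀) = ε ^ 2 / (512 * k ^ 3) := by
      rw [hε₀, hα, hη]; field_simp; ring
    have e5 : ε ^ 2 / (512 * (k : ℝ) ^ 3) ≤ ε / 8 := by
      rw [div_le_iff₀ (by positivity)]
      nlinarith [mul_pos hε hk0, hk3']
    have hN2 : (0 : ℝ) ≤ (Fintype.card β : ℝ) ^ 2 := by positivity
    calc (4 * ε₀ + ε₁ / 2 + 4 * η) * (k * Fintype.card β) ^ 2 +
          2 * (k * α * (k * Fintype.card β)) * (k * Fintype.card β)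
        = ((k : ℝ) ^ 2 * (4 * ε₀) + k ^ 2 * (ε₁ / 2) + k ^ 2 * (4 * η) + 2 * k ^ 3 * α) *
            (Fintype.card β : ℝ) ^ 2 := by ring
      _ ≤ (ε / 8 + ε / 4 + ε / 4 + ε / 8) * (Fintype.card β : ℝ) ^ 2 := by
          apply mul_le_mul_of_nonneg_right _ hN2
          rw [e1, e2, e3, e4]
          linarith
      _ ≤ ε * (Fintype.card β) ^ 2 := by
          apply mul_le_mul_of_nonneg_right _ hN2
          linarith
  · -- no around tuple survives
    rw [eq_empty_iff_forall_notMem]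
    intro y hy
    have h1 := le_card_aroundSet_of_mem_cleaned Γ P hP₁ hP₃ hε₀α (by linarith) hαpos.le hε₀η
      (by linarith) hquot hy
    rw [hcardV] at h1
    have h2 : c * (Fintype.card β : ℝ) ^ (n + 3) ≤ #(aroundSet Γ) := by
      rw [hc]
      calc (η / 2 / 4) ^ (n + 3) * (α * (k / (2 * b))) ^ (n + 3) * (Fintype.card β : ℝ) ^ (n + 3)
          = (η / 2 / 4) ^ (n + 3) * (α * (k * Fintype.card β / (2 * b))) ^ (n + 3) := by
            rw [mul_assoc, ← mul_pow]; ring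
        _ ≤ _ := h1
    have hN1 : (1 : ℝ) ≤ Fintype.card β := by exact_mod_cast hNpos
    have key : c * (Fintype.card β : ℝ) ^ (n + 3) ≤ c / 2 * (Fintype.card β : ℝ) ^ (n + 3) :=
      calc c * (Fintype.card β : ℝ) ^ (n + 3) ≤ #(aroundSet Γ) := h2
        _ ≤ min (1 / (2 * (l : ℝ) ^ (n + 3))) (c / 2) * (Fintype.card β) ^ (n + 3) := hfew
        _ ≤ c / 2 * (Fintype.card β : ℝ) ^ (n + 3) :=
            mul_le_mul_of_nonneg_right (min_le_right _ _) (by positivity)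
    have : (0 : ℝ) < (Fintype.card β : ℝ) ^ (n + 3) := by positivity
    have h3 : c ≤ c / 2 := le_of_mul_le_mul_right key this
    linarith

end Removal

/-! ### The Cayley layered graph of a family of sets in an abelian group -/

section Cayley

variable {G : Type*} [AddCommGroup G] [DecidableEq G]

omit Γ [DecidableRel Γ.Adj] in
/-- In `Fin (n+3)` one has `i ≠ i + 1 + 1`. [folklore] -/
theorem fin_ne_add_two {n : ℕ} (i : Fin (n + 3)) : i ≠ i + 1 + 1 := by
  intro h
  rw [add_assoc, left_eq_add] at h
  have : ((1 : Fin (n + 3)) + 1).val = 0 := by rw [h]; rfl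
  rw [Fin.val_add, Fin.val_one] at this
  have h2 : (1 + 1) % (n + 3) = 1 + 1 := Nat.mod_eq_of_lt (by omega)
  omega

omit Γ [DecidableRel Γ.Adj] in
/-- In `Fin (n+3)` one has `i ≠ i + 1`. [folklore] -/
theorem fin_ne_add_one {n : ℕ} (i : Fin (n + 3)) : i ≠ i + 1 := by
  intro h
  rw [left_eq_add, Fin.one_eq_zero_iff] at h
  omega

omit Γ [DecidableRel Γ.Adj] in
/-- The layered Cayley sum graph of `A : Fin k → Finset G` on `Fin k × G` (`k ≥ 3`):
`(i, x) ∼ (i + 1, y)` iff `y - x ∈ A i` (Král'–Serra–Vena's graph, undirected; for `k ≥ 3` the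
pair of layers determines the direction). [cite: KralSerraVena2009, §2] -/
def cayleyLayered {n : ℕ} (A : Fin (n + 3) → Finset G) : SimpleGraph (Fin (n + 3) × G) where
  Adj v w := (w.1 = v.1 + 1 ∧ w.2 - v.2 ∈ A v.1) ∨ (v.1 = w.1 + 1 ∧ v.2 - w.2 ∈ A w.1)
  symm := ⟨fun _ _ h => h.symm⟩
  loopless := ⟨fun v h => by
    rcases h with ⟨h, -⟩ | ⟨h, -⟩ <;> exact fin_ne_add_one v.1 h⟩

omit Γ [DecidableRel Γ.Adj] in
/-- Adjacency in the layered Cayley graph is decidable. [folklore] -/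
instance cayleyLayered.instDecidableRelAdj {n : ℕ} (A : Fin (n + 3) → Finset G) :
    DecidableRel (cayleyLayered A).Adj := fun v w =>
  inferInstanceAs (Decidable ((w.1 = v.1 + 1 ∧ w.2 - v.2 ∈ A v.1) ∨
    (v.1 = w.1 + 1 ∧ v.2 - w.2 ∈ A w.1)))

omit Γ [DecidableRel Γ.Adj] [DecidableEq G] in
/-- Adjacency between consecutive layers reads off membership in `A i`. [folklore] -/
theorem cayleyLayered_adj_iff {n : ℕ} (A : Fin (n + 3) → Finset G) (i : Fin (n + 3))
    (x y : G) : (cayleyLayered A).Adj (i, x) (i + 1, y) ↔ y - x ∈ A i := by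
  constructor
  · rintro (⟨-, h⟩ | ⟨h, -⟩)
    · exact h
    · exact absurd h (fin_ne_add_two i)
  · intro h
    exact Or.inl ⟨rfl, h⟩

variable [Fintype G]

omit Γ [DecidableRel Γ.Adj] in
/-- Around tuples of the Cayley layered graph inject into (base point) × (zero-sum tuples of
`∏ A i`) via `y ↦ (y 0, (y (i+1) - y i)_i)`. [cite: KralSerraVena2009, §2] -/
theorem card_aroundSet_cayleyLayered_le {n : ℕ} (A : Fin (n + 3) → Finset G) :
    #(aroundSet (cayleyLayered A)) ≤
      Fintype.card G * #((Fintype.piFinset A).filter fun a => ∑ i, a i = 0) := by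
  rw [← card_univ, ← card_product]
  refine card_le_card_of_injOn (fun y => (y 0, fun i => y (i + 1) - y i)) (fun y hy => ?_) ?_
  · rw [mem_coe, aroundSet, mem_filter] at hy
    rw [mem_coe, mem_product, mem_filter, Fintype.mem_piFinset]
    refine ⟨mem_univ _, fun i => (cayleyLayered_adj_iff A i _ _).1 (hy.2 i), ?_⟩
    rw [sum_sub_distrib, sub_eq_zero]
    exact Equiv.sum_comp (Equiv.addRight (1 : Fin (n + 3))) y
  · intro y _ y' _ h
    simp only [Prod.mk.injEq] at h
    obtain ⟨h0, h1⟩ := h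
    funext i
    refine Fin.induction h0 (fun j hj => ?_) i
    have := congr_fun h1 j.castSucc
    simp only [Fin.coeSucc_eq_succ] at this
    rw [← sub_add_cancel (y j.succ) (y j.castSucc), this, hj, sub_add_cancel]

/-- The number of base points `x` for which the edge `(i, x) ∼ (i+1, x + a)` is missing in
`Γ'`. [folklore] -/
def badCount {n : ℕ} (Γ' : SimpleGraph (Fin (n + 3) × G)) [DecidableRel Γ'.Adj]
    (i : Fin (n + 3)) (a : G) : ℕ :=
  #(univ.filter fun x : G => ¬ Γ'.Adj (i, x) (i + 1, x + a))

omit Γ [DecidableRel Γ.Adj] in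
/-- For a subgraph `Γ'` of the Cayley layered graph, the missing edges labelled by the elements
of `A i` are removed pairs: `∑_{a ∈ A i} badCount Γ' i a ≤ #removedPairs`. [folklore] -/
theorem sum_badCount_le {n : ℕ} (A : Fin (n + 3) → Finset G)
    (Γ' : SimpleGraph (Fin (n + 3) × G)) [DecidableRel Γ'.Adj] (i : Fin (n + 3)) :
    ∑ a ∈ A i, badCount Γ' i a ≤ #(removedPairs (cayleyLayered A) Γ') := by
  have h1 : ∑ a ∈ A i, badCount Γ' i a =
      #((A i ×ˢ (univ : Finset G)).filter fun p => ¬ Γ'.Adj (i, p.2) (i + 1, p.2 + p.1)) := by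
    rw [card_filter, sum_product]
    refine sum_congr rfl fun a _ => ?_
    rw [badCount, card_filter]
  rw [h1]
  refine card_le_card_of_injOn (fun p => ((i, p.2), (i + 1, p.2 + p.1))) (fun p hp => ?_) ?_
  · rw [mem_coe, mem_filter, mem_product] at hp
    rw [mem_coe, removedPairs, mem_filter]
    refine ⟨mem_univ _, ?_, hp.2⟩
    rw [cayleyLayered_adj_iff]
    simpa using hp.1.1
  · intro p _ q _ h
    simp only [Prod.mk.injEq] at h
    obtain ⟨⟨-, h2⟩, -, h3⟩ := h
    rw [h2] at h3
    exact Prod.ext (add_left_cancel h3) h2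

omit Γ [DecidableRel Γ.Adj] [DecidableEq G] [Fintype G] in
/-- Partial sums: for `a : Fin k → G` with `∑ a = 0` there is `p : Fin k → G` with
`p (i + 1) - p i = a i` for all `i` (indices mod `k`). [folklore] -/
theorem exists_partialSum {n : ℕ} (a : Fin (n + 3) → G) (ha : ∑ i, a i = 0) :
    ∃ p : Fin (n + 3) → G, ∀ i, p (i + 1) - p i = a i := by
  set a' : ℕ → G := fun j => if h : j < n + 3 then a ⟨j, h⟩ else 0 with ha'
  have ha'v : ∀ i : Fin (n + 3), a' i = a i := fun i => by
    simp [ha', i.isLt]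
  have ha2 : ∑ j ∈ range (n + 3), a' j = 0 := by
    rw [← Fin.sum_univ_eq_sum_range, ← ha]
    exact Fintype.sum_congr _ _ ha'v
  have hl : a' (n + 2) = a (Fin.last (n + 2)) := by
    have := ha'v (Fin.last (n + 2)); rwa [Fin.val_last] at this
  refine ⟨fun i => ∑ j ∈ range i, a' j, fun i => ?_⟩
  show ∑ j ∈ range ((i + 1 : Fin (n + 3)) : ℕ), a' j - ∑ j ∈ range (i : ℕ), a' j = a i
  rcases eq_or_ne i (Fin.last (n + 2)) with h | h
  · rw [h, Fin.last_add_one, Fin.val_zero, range_zero, Finset.sum_empty, Fin.val_last, zero_sub,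
      neg_eq_iff_add_eq_zero, ← hl, ← sum_range_succ]
    exact ha2
  · rw [Fin.val_add_one_of_lt (lt_of_le_of_ne (Fin.le_last i) h), sum_range_succ, ha'v]
    abel

omit Γ [DecidableRel Γ.Adj] [DecidableEq G] in
/-- Translating a finset count. [folklore] -/
theorem card_filter_add_right (c : G) (Q : G → Prop) [DecidablePred Q] :
    #(univ.filter fun x : G => Q (x + c)) = #(univ.filter Q) := by
  refine card_bij (fun x _ => x + c) (fun x hx => ?_) (fun x _ y _ h => add_right_cancel h)
    (fun y hy => ⟨y - c, ?_, sub_add_cancel y c⟩)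
  · rw [mem_filter] at hx ⊢
    exact ⟨mem_univ _, hx.2⟩
  · rw [mem_filter] at hy ⊢
    rw [sub_add_cancel]
    exact ⟨mem_univ _, hy.2⟩

omit Γ [DecidableRel Γ.Adj] in
/-- **No solution survives.** If `Γ'` has no around tuple and every `a i ∈ A i` labels fewer
than `N / k` missing edges of `Γ'`, then `∑ a i ≠ 0`. [cite: KralSerraVena2009, §2] -/
theorem sum_ne_zero_of_aroundSet_eq_empty {n : ℕ} (Γ' : SimpleGraph (Fin (n + 3) × G))
    [DecidableRel Γ'.Adj] (hΓ' : aroundSet Γ' = ∅) (a : Fin (n + 3) → G)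
    (ha : ∀ i, (n + 3) * badCount Γ' i (a i) < Fintype.card G) : ∑ i, a i ≠ 0 := by
  intro hsum
  obtain ⟨p, hp⟩ := exists_partialSum a hsum
  -- every base point gives an around tuple of differences `a`, which must miss an edge of `Γ'`
  have hcover : (univ : Finset G) ⊆ (univ : Finset (Fin (n + 3))).biUnion fun i =>
      univ.filter fun x₀ : G => ¬ Γ'.Adj (i, x₀ + p i) (i + 1, (x₀ + p i) + a i) := by
    intro x₀ _
    rw [mem_biUnion]
    by_contra hcon
    push Not at hcon
    have hmem : (fun i => x₀ + p i) ∈ aroundSet Γ' := by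
      rw [aroundSet, mem_filter]
      refine ⟨mem_univ _, fun i => ?_⟩
      have := hcon i (mem_univ i)
      rw [mem_filter, not_and, not_not] at this
      have h := this (mem_univ _)
      have e : x₀ + p (i + 1) = x₀ + p i + a i := by rw [← hp i]; abel
      show Γ'.Adj (i, x₀ + p i) (i + 1, x₀ + p (i + 1))
      rw [e]; exact h
    rw [hΓ'] at hmem
    exact notMem_empty _ hmem
  have h1 : Fintype.card G ≤ ∑ i : Fin (n + 3), badCount Γ' i (a i) := by
    calc Fintype.card G = #(univ : Finset G) := (card_univ).symm
      _ ≤ #((univ : Finset (Fin (n + 3))).biUnion fun i =>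
          univ.filter fun x₀ : G => ¬ Γ'.Adj (i, x₀ + p i) (i + 1, (x₀ + p i) + a i)) :=
          card_le_card hcover
      _ ≤ ∑ i, #(univ.filter fun x₀ : G => ¬ Γ'.Adj (i, x₀ + p i) (i + 1, (x₀ + p i) + a i)) :=
          card_biUnion_le
      _ = ∑ i, badCount Γ' i (a i) := by
          refine sum_congr rfl fun i _ => ?_
          rw [badCount]
          exact card_filter_add_right (p i) (fun x => ¬ Γ'.Adj (i, x) (i + 1, x + a i))
  have h2 : (n + 3) * ∑ i : Fin (n + 3), badCount Γ' i (a i) < (n + 3) * Fintype.card G := by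
    calc (n + 3) * ∑ i : Fin (n + 3), badCount Γ' i (a i)
        = ∑ i : Fin (n + 3), (n + 3) * badCount Γ' i (a i) := by rw [mul_sum]
      _ < ∑ _i : Fin (n + 3), Fintype.card G := sum_lt_sum_of_nonempty univ_nonempty fun i _ => ha i
      _ = (n + 3) * Fintype.card G := by rw [sum_const, card_univ, Fintype.card_fin, smul_eq_mul]
  have h3 : (n + 3) * Fintype.card G ≤ (n + 3) * ∑ i : Fin (n + 3), badCount Γ' i (a i) :=
    Nat.mul_le_mul_left _ h1
  omega

end Cayley

end Literature.Combinatorics.Additive.KralSerraVena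

/-! ### Proof of Green's Theorem 1.5 -/

namespace Literature.Combinatorics.Additive

open KralSerraVena in
/-- The removal lemma for `k = n + 3` sets, all constants explicit in terms of
`KralSerraVena.around_cycle_removal`. [cite: Green2005, Thm. 1.5] -/
theorem arithmetic_removal_aux (n : ℕ) {ε : ℝ} (hε : 0 < ε) : ∃ δ : ℝ, 0 < δ ∧
    ∀ (G : Type) [AddCommGroup G] [Fintype G] [DecidableEq G] (A : Fin (n + 3) → Finset G),
      ((((Fintype.piFinset A).filter fun a => ∑ i, a i = 0).card : ℕ) : ℝ) ≤
          δ * (Fintype.card G : ℝ) ^ (n + 2) →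
        ∃ A' : Fin (n + 3) → Finset G, (∀ i, A' i ⊆ A i) ∧
          (∀ i, (((A i \ A' i).card : ℕ) : ℝ) ≤ ε * (Fintype.card G : ℝ)) ∧
          ∀ a ∈ Fintype.piFinset A', ∑ i, a i ≠ 0 := by
  have hk0 : (0 : ℝ) < n + 3 := by positivity
  obtain ⟨δ, hδ, hrem⟩ := around_cycle_removal n (ε := min (ε / (n + 3)) 1)
    (lt_min (by positivity) one_pos) (min_le_right _ _)
  refine ⟨δ, hδ, ?_⟩
  intro G _ _ _ A hfew
  have hN : (0 : ℝ) < Fintype.card G := by exact_mod_cast Fintype.card_pos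
  -- the layered graph has few around tuples
  have h1 : (#(aroundSet (cayleyLayered A)) : ℝ) ≤ δ * (Fintype.card G : ℝ) ^ (n + 3) := by
    calc (#(aroundSet (cayleyLayered A)) : ℝ)
        ≤ Fintype.card G * #((Fintype.piFinset A).filter fun a => ∑ i, a i = 0) := by
          exact_mod_cast card_aroundSet_cayleyLayered_le A
      _ ≤ Fintype.card G * (δ * (Fintype.card G : ℝ) ^ (n + 2)) :=
          mul_le_mul_of_nonneg_left hfew hN.le
      _ = δ * (Fintype.card G : ℝ) ^ (n + 3) := by ring
  obtain ⟨Γ', hdec, hle, hpairs, hempty⟩ := hrem G (cayleyLayered A) h1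
  -- remove the elements labelling many missing edges
  refine ⟨fun i => (A i).filter fun a => (n + 3) * badCount Γ' i a < Fintype.card G,
    fun i => filter_subset _ _, fun i => ?_, fun a ha => ?_⟩
  · have hR : ∀ a ∈ A i \ (A i).filter (fun a => (n + 3) * badCount Γ' i a < Fintype.card G),
        Fintype.card G ≤ (n + 3) * badCount Γ' i a := by
      intro a ha
      rw [mem_sdiff, mem_filter, not_and, not_lt] at ha
      exact ha.2 ha.1
    have h2 : #(A i \ (A i).filter (fun a => (n + 3) * badCount Γ' i a < Fintype.card G)) *
        Fintype.card G ≤ (n + 3) * #(removedPairs (cayleyLayered A) Γ') := by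
      calc #(A i \ (A i).filter (fun a => (n + 3) * badCount Γ' i a < Fintype.card G)) *
            Fintype.card G
          = ∑ a ∈ A i \ (A i).filter (fun a => (n + 3) * badCount Γ' i a < Fintype.card G),
              Fintype.card G := by rw [sum_const, smul_eq_mul]
        _ ≤ ∑ a ∈ A i \ (A i).filter (fun a => (n + 3) * badCount Γ' i a < Fintype.card G),
              (n + 3) * badCount Γ' i a := sum_le_sum hR
        _ ≤ ∑ a ∈ A i, (n + 3) * badCount Γ' i a :=
            sum_le_sum_of_subset_of_nonneg sdiff_subset fun _ _ _ => Nat.zero_le _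
        _ = (n + 3) * ∑ a ∈ A i, badCount Γ' i a := by rw [mul_sum]
        _ ≤ (n + 3) * #(removedPairs (cayleyLayered A) Γ') :=
            Nat.mul_le_mul_left _ (sum_badCount_le A Γ' i)
    have h3 : (#(A i \ (A i).filter (fun a => (n + 3) * badCount Γ' i a < Fintype.card G)) : ℝ) *
        Fintype.card G ≤ (n + 3) * (min (ε / (n + 3)) 1 * (Fintype.card G : ℝ) ^ 2) := by
      have h2' : (#(A i \ (A i).filter (fun a => (n + 3) * badCount Γ' i a < Fintype.card G)) : ℝ) *
          Fintype.card G ≤ (n + 3) * #(removedPairs (cayleyLayered A) Γ') := by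
        exact_mod_cast h2
      exact h2'.trans (mul_le_mul_of_nonneg_left hpairs hk0.le)
    have h4 : (n + 3) * (min (ε / (n + 3)) 1 * (Fintype.card G : ℝ) ^ 2) ≤
        ε * Fintype.card G * Fintype.card G := by
      have : (n + 3) * min (ε / (n + 3)) 1 ≤ ε := by
        calc (n + 3) * min (ε / (n + 3)) 1 ≤ (n + 3) * (ε / (n + 3)) :=
              mul_le_mul_of_nonneg_left (min_le_left _ _) hk0.le
          _ = ε := by field_simp
      nlinarith [this, hN]
    exact le_of_mul_le_mul_right (h3.trans (by linarith [h4])) hN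
  · rw [Fintype.mem_piFinset] at ha
    exact sum_ne_zero_of_aroundSet_eq_empty Γ' hempty a fun i => (mem_filter.1 (ha i)).2

/-- **Green's arithmetic removal lemma** (Green 2005, Thm. 1.5), discharging the named fact
`Green2005_1_5`: for `k ≥ 3` and `ε > 0` there is `δ > 0` such that for every finite abelian
group `G` and `A_1, …, A_k ⊆ G` with at most `δ |G|^{k-1}` zero-sum `k`-tuples in `∏ A_i`, one can
delete at most `ε |G|` elements from each `A_i` and destroy all zero-sum `k`-tuples.

The proof formalised here is NOT Green's Fourier-analytic one (arithmetic regularity lemma,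
ibid. Thm. 5.3) but the combinatorial proof of Král'–Serra–Vena (2009, Thm. 1.1/§2, which covers
all finite groups): the zero-sum `k`-tuples with a base point are the "around" `k`-cycles of the
layered Cayley graph on `Fin k × G` (`KralSerraVena.cayleyLayered`), the removal lemma for such
cycles (`KralSerraVena.around_cycle_removal`, from Mathlib's Szemerédi regularity lemma and the
cycle counting lemma `KralSerraVena.le_card_cycSet`) deletes few edges, an element of `A_i` is
deleted when at least `|G|/k` of its `|G|` edges are gone, and a surviving zero-sum tuple would
give `|G|` edge-disjoint around cycles each missing an edge — too many.
[cite: Green2005, Thm. 1.5] -/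
theorem Green2005_1_5_holds : Green2005_1_5 := by
  intro k hk ε hε
  obtain ⟨n, rfl⟩ : ∃ n, k = n + 3 := ⟨k - 3, by omega⟩
  obtain ⟨δ, hδ, h⟩ := arithmetic_removal_aux n hε
  refine ⟨δ, hδ, fun G _ _ _ A hA => ?_⟩
  exact h G A (by simpa using hA)

end Literature.Combinatorics.Additive
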